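import Literature.Computability.AlgebraicComplexity.BDI20HwvEvaluationNPHardProofs
import HarnessLib

/-!
# Bläser–Dörfler–Ikenmeyer 2020/21, Thm 8.1 (arXiv Thm 22), ETH clause — the combinatorial core:
# a linear-size graph of maximum degree `4` that is `3`-colourable iff a `3`-CNF is satisfiable

Theorem-only companion of `BDI20HwvEvaluationHardness.lean` (cell `val-lit`, seat x6), second of
three files discharging the named fact `BDI2020_thm_8_1_eth` ("Assuming ETH no `2^{o(n)}` algorithm
for this evaluation can exist", BDI CCC 2021 Thm 8.1 = arXiv Thm 22). No new named fact, no
`instance`, no `notation`; every `def` is bodied plumbing (label arithmetic, the edge test, the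
explicit colouring). HONEST FRAMING: an explicit fine-grained (linear-parameter) version of the
textbook reduction `3-SAT ≤ 3-COLOURABILITY` followed by the Garey–Johnson–Stockmeyer degree
reduction; nothing here bears on `VP ≠ VNP`, which is NOT proved.

## Why this file (the printed proof and our deviation, disclosed)

The printed ETH clause of Thm 8.1 rests on (i) the tableau construction `G ↦ T̂_G` of the
NP-hardness proof (in the tree: `BDI20NPHard.graphTableau`, with `f_{T̂_G}(p_d) ≠ 0 ⟺ G` is
properly `3`-colourable, `BDI20NPHard.hwvEvalWaring_graphTableau_ne_zero_iff_coloring`, and content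
`N × d` as soon as every label lies on `≤ d/2` edges, `BDI20NPHard.isTableauOfContent_graphTableau`),
whose number of labels is the number of vertices of `G`, and (ii) the folklore fact that, under ETH,
`3`-colourability of graphs of maximum degree `4` has no `2^{o(|V|)}` algorithm — sparsification
(Impagliazzo–Paturi–Zane) plus the LINEAR size of the classical reductions. The tree's NP-hardness
discharge (`BDI20HwvEvaluationNPHardProofs.lean`) realises [GJS76] by a gadget with `4n²` labels
(quadratic in `|V|`), which is useless for (ii). This file supplies a construction with LINEARLY many
labels directly from a `3`-CNF with `m` clauses: the graph `BDI20SatGraph.adj m var pol` on the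
`32 m + 9` labels `0, …, 32m + 8`, built from the OCCURRENCE DATA of the formula — occurrence
`r = 3j + p` (`j < m`, `p < 3`) carries the variable `var r` and the polarity `pol r` of the `p`-th
literal of clause `j` (clauses of width `< 3` are padded by repeating their first literal, see
`litOf`) — as follows (all "slots" are diamonds `u x y w` with the edges `ux uy xy xw yw`, forcing
`colour w = colour u` and `{colour x, colour y} =` the other two colours):

* label `0` is the vertex `T₀`; slots `k < 2 + 5m` (labels `1 + 4k + t`): the `B`-chain
  `k < 1 + 4m` (head `k = 0`, one slot `1 + r` per occurrence `r < 3m`, one slot `1 + 3m + j` per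
  clause `j`) and the `F`-chain `1 + 4m ≤ k` (head, one slot `2 + 4m + j` per clause); consecutive
  slots of one chain are linked by `x_k u_{k+1}`, `y_k u_{k+1}` (all `u`, `w` of a chain carry one
  colour), and `T₀`, `u_0 = B₀`, `u_{1+4m} = F₀` form the palette triangle;
* units `r < 3m` (labels `9 + 20m + 2r + s`): `a_r` (`s = 0`) and `b_r` (`s = 1`) with the edges
  `a_r b_r`, `a_r w_{1+r}`, `b_r w_{1+r}` (so `{colour a_r, colour b_r} = {T, F}`), and the
  variable-consistency edge `b_{r₀} a_r` from the PREVIOUS occurrence `r₀` of the same variable (so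
  `colour a_r = colour a_{r₀}`; along a variable all `a` carry its truth value);
* the clause gadget `j < m` (labels `9 + 26m + 6j + t`, `t = g₁ g₂ o h₁ h₂ out`): the two nested
  Garey–Johnson OR-gadgets `g₁g₂, og₁, og₂, h₁o, h₁h₂, out h₁, out h₂`, inputs `g₁ ~ port(3j)`,
  `g₂ ~ port(3j+1)`, `h₂ ~ port(3j+2)` where `port(r) = a_r` if `pol r` else `b_r`, and
  `out ~ w_{1+3m+j}` (`B`), `out ~ w_{2+4m+j}` (`F`), forcing `colour out = T`.

Every label has at most `4` neighbours (`edgeDeg_adj_le`), and the graph is properly `3`-colourable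
iff the formula is satisfiable (`exists_proper_iff_satisfiable`, for CNFs with nonempty clauses of
width `≤ 3`). The third file (`BDI20HwvEvaluationETHProofs.lean`) computes this instance map on codes
and assembles the SERF reduction from `3`-SAT with parameter `m`.

## References
* [BlaserDorflerIkenmeyer2020] M. Bläser, J. Dörfler, C. Ikenmeyer, *On the complexity of evaluating
  highest weight vectors*, arXiv:2002.11594, Thm 22 and its proof (p.17: "We use the NP-hardness of
  3-coloring graphs of maximum degree at most 4 [GJS76] … Assuming ETH no `2^{o(n)}` algorithm for
  this evaluation can exist.") = CCC 2021, LIPIcs 200:29, Thm 8.1.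
* [GareyJohnsonStockmeyer1976] M. R. Garey, D. S. Johnson, L. J. Stockmeyer, *Some simplified
  NP-complete graph problems*, Theoret. Comput. Sci. 1 (1976) 237–267, Thm 2.1 (`3-SAT ∝ GRAPH
  3-COLOURABILITY`, the OR-gadget) and §2 (graph 3-colourability with no vertex degree exceeding 4,
  the vertex substitute).
* [ImpagliazzoPaturiZaneJCSS2001] R. Impagliazzo, R. Paturi, F. Zane, *Which problems have strongly
  exponential complexity?*, JCSS 63 (2001), §2 (SERF reductions preserve the parameter linearly).
-/

namespace Literature.Computability.AlgebraicComplexity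

namespace BDI20SatGraph

open Literature.Computability.Complexity BDI20NPHard

/-! ### §1. Label arithmetic -/

section Labels

variable (m : ℕ)

/-- Number of `B`-chain slots: head, one per occurrence, one per clause. [cite: GareyJohnsonStockmeyer1976, §2 (vertex substitute; our explicit variant)] -/
def KB : ℕ := 1 + 4 * m

/-- Number of slots (`B`-chain then `F`-chain). [cite: GareyJohnsonStockmeyer1976, §2 (our explicit variant)] -/
def KS : ℕ := 2 + 5 * m

/-- First unit label (`1 + 4·KS`). [cite: GareyJohnsonStockmeyer1976, §2 (our explicit variant)] -/
def U0 : ℕ := 9 + 20 * m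

/-- First gadget label (`U0 + 2·3m`). [cite: GareyJohnsonStockmeyer1976, Thm 2.1 (our explicit variant)] -/
def G0 : ℕ := 9 + 26 * m

/-- **Number of labels** `32m + 9`. [cite: BlaserDorflerIkenmeyer2020, Thm 22 (proof: content n × d, n = |V|)] -/
def nLab : ℕ := 9 + 32 * m

/-- Label of slot `k`, type `t ∈ {u,x,y,w} = {0,1,2,3}`. [cite: GareyJohnsonStockmeyer1976, §2 (our explicit variant)] -/
def slotL (k t : ℕ) : ℕ := 1 + 4 * k + t

/-- Label of unit `r`, side `s` (`a_r`: `s = 0`, `b_r`: `s = 1`). [cite: GareyJohnsonStockmeyer1976, Thm 2.1 (our explicit variant)] -/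
def unitL (r s : ℕ) : ℕ := U0 m + 2 * r + s

/-- Label of node `t ∈ {g₁,g₂,o,h₁,h₂,out} = {0,…,5}` of clause gadget `j`. [cite: GareyJohnsonStockmeyer1976, Thm 2.1 (OR-gadget)] -/
def gadL (j t : ℕ) : ℕ := G0 m + 6 * j + t

/-- Slot index of a label. [cite: GareyJohnsonStockmeyer1976, §2 (our explicit variant)] -/
def sk (a : ℕ) : ℕ := (a - 1) / 4
/-- Slot type of a label. [cite: GareyJohnsonStockmeyer1976, §2 (our explicit variant)] -/
def st (a : ℕ) : ℕ := (a - 1) % 4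
/-- Occurrence of a unit label. [cite: GareyJohnsonStockmeyer1976, Thm 2.1 (our explicit variant)] -/
def ur (a : ℕ) : ℕ := (a - U0 m) / 2
/-- Side of a unit label. [cite: GareyJohnsonStockmeyer1976, Thm 2.1 (our explicit variant)] -/
def us (a : ℕ) : ℕ := (a - U0 m) % 2
/-- Clause of a gadget label. [cite: GareyJohnsonStockmeyer1976, Thm 2.1 (OR-gadget)] -/
def gj (a : ℕ) : ℕ := (a - G0 m) / 6
/-- Node type of a gadget label. [cite: GareyJohnsonStockmeyer1976, Thm 2.1 (OR-gadget)] -/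
def gt (a : ℕ) : ℕ := (a - G0 m) % 6

/-- Slot labels. [cite: GareyJohnsonStockmeyer1976, §2 (our explicit variant)] -/
def isSlot (a : ℕ) : Bool := decide (1 ≤ a) && decide (a < U0 m)
/-- Unit labels. [cite: GareyJohnsonStockmeyer1976, Thm 2.1 (our explicit variant)] -/
def isUnit (a : ℕ) : Bool := decide (U0 m ≤ a) && decide (a < G0 m)
/-- Gadget labels. [cite: GareyJohnsonStockmeyer1976, Thm 2.1 (OR-gadget)] -/
def isGad (a : ℕ) : Bool := decide (G0 m ≤ a) && decide (a < nLab m)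

/-- The occurrence feeding gadget node `t` (`g₁ ↦ 0`, `g₂ ↦ 1`, `h₂ ↦ 2`). [cite: GareyJohnsonStockmeyer1976, Thm 2.1 (OR-gadget)] -/
def pos (t : ℕ) : ℕ := if t = 4 then 2 else t

end Labels

/-! ### §2. The edge test -/

section Edges

variable (m : ℕ) (var : ℕ → ℕ) (pol : ℕ → Bool)

/-- "no occurrence of the variable of `r` strictly between `r₀` and `r`". [cite: GareyJohnsonStockmeyer1976, §2 (our explicit variant)] -/
def noneBetween (r₀ r : ℕ) : Bool :=
  (List.range r).all fun i => decide (i ≤ r₀) || !decide (var i = var r)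

/-- R1: the diamond of a slot (`ux, uy, xy, xw, yw`). [cite: GareyJohnsonStockmeyer1976, §2 (our explicit variant)] -/
def R1 (a b : ℕ) : Bool :=
  isSlot m a && isSlot m b && decide (sk a = sk b) &&
    ((decide (st a = 0) && (decide (st b = 1) || decide (st b = 2))) ||
      (decide (st a = 1) && (decide (st b = 2) || decide (st b = 3))) ||
      (decide (st a = 2) && decide (st b = 3)))

/-- R2: chain links `x_k u_{k+1}`, `y_k u_{k+1}` inside one chain. [cite: GareyJohnsonStockmeyer1976, §2 (our explicit variant)] -/
def R2 (a b : ℕ) : Bool :=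
  isSlot m a && isSlot m b && decide (sk b = sk a + 1) && !decide (sk b = KB m) &&
    (decide (st a = 1) || decide (st a = 2)) && decide (st b = 0)

/-- R3: the palette triangle `T₀ B₀ F₀`. [cite: GareyJohnsonStockmeyer1976, Thm 2.1] -/
def R3 (a b : ℕ) : Bool :=
  (decide (a = 0) && (decide (b = 1) || decide (b = slotL (KB m) 0))) ||
    (decide (a = 1) && decide (b = slotL (KB m) 0))

/-- R4: `a_r b_r`. [cite: GareyJohnsonStockmeyer1976, Thm 2.1 (x_i, x̄_i adjacent)] -/
def R4 (a b : ℕ) : Bool :=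
  isUnit m a && isUnit m b && decide (ur m a = ur m b) && decide (us m a = 0) && decide (us m b = 1)

/-- R5: `a_r w_{1+r}`, `b_r w_{1+r}` (both units see `B`). [cite: GareyJohnsonStockmeyer1976, Thm 2.1 (literals adjacent to the base vertex)] -/
def R5 (a b : ℕ) : Bool :=
  isUnit m a && isSlot m b && decide (sk b = 1 + ur m a) && decide (st b = 3)

/-- R6: `b_{r₀} a_r` for the previous occurrence `r₀` of the variable of `r`. [cite: GareyJohnsonStockmeyer1976, §2 (vertex substitute; our explicit variant)] -/
def R6 (a b : ℕ) : Bool :=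
  isUnit m a && isUnit m b && decide (us m a = 1) && decide (us m b = 0) && decide (ur m a < ur m b) &&
    decide (var (ur m a) = var (ur m b)) && noneBetween var (ur m a) (ur m b)

/-- R7: the gadget edges `g₁g₂, og₁, og₂, h₁o, h₁h₂, out h₁, out h₂`. [cite: GareyJohnsonStockmeyer1976, Thm 2.1 (OR-gadget)] -/
def R7 (a b : ℕ) : Bool :=
  isGad m a && isGad m b && decide (gj m a = gj m b) &&
    ((decide (gt m a = 0) && (decide (gt m b = 1) || decide (gt m b = 2))) ||
      (decide (gt m a = 1) && decide (gt m b = 2)) ||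
      (decide (gt m a = 2) && decide (gt m b = 3)) ||
      (decide (gt m a = 3) && (decide (gt m b = 4) || decide (gt m b = 5))) ||
      (decide (gt m a = 4) && decide (gt m b = 5)))

/-- R8: the gadget inputs `port(3j) g₁`, `port(3j+1) g₂`, `port(3j+2) h₂`. [cite: GareyJohnsonStockmeyer1976, Thm 2.1 (OR-gadget inputs)] -/
def R8 (a b : ℕ) : Bool :=
  isUnit m a && isGad m b && (decide (gt m b = 0) || decide (gt m b = 1) || decide (gt m b = 4)) &&
    decide (ur m a = 3 * gj m b + pos (gt m b)) && decide (us m a = if pol (ur m a) then 0 else 1)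

/-- R9: `out_j w_{1+3m+j}` (`B`) and `out_j w_{2+4m+j}` (`F`). [cite: GareyJohnsonStockmeyer1976, Thm 2.1 (clause output adjacent to B and F)] -/
def R9 (a b : ℕ) : Bool :=
  isGad m a && decide (gt m a = 5) && isSlot m b && decide (st b = 3) &&
    (decide (sk b = 1 + 3 * m + gj m a) || decide (sk b = KB m + 1 + gj m a))

/-- The directed edge test. [cite: BlaserDorflerIkenmeyer2020, Thm 22 (proof)] -/
def dirAdj (a b : ℕ) : Bool :=
  R1 m a b || R2 m a b || R3 m a b || R4 m a b || R5 m a b || R6 m var a b || R7 m a b ||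
    R8 m pol a b || R9 m a b

/-- **The edge test of the graph `G_φ`** (symmetric). [cite: BlaserDorflerIkenmeyer2020, Thm 22 (proof)] -/
def adj (a b : ℕ) : Bool := dirAdj m var pol a b || dirAdj m var pol b a

end Edges

/-! ### §3. Coordinates of the constructors -/

section Coord

variable (m : ℕ)

/-- Slot index of a slot label. [cite: GareyJohnsonStockmeyer1976, §2 (our explicit variant)] -/
@[simp] theorem sk_slotL (k t : ℕ) (ht : t < 4) : sk (slotL k t) = k := by unfold sk slotL; omega
/-- Slot type of a slot label. [cite: GareyJohnsonStockmeyer1976, §2 (our explicit variant)] -/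
@[simp] theorem st_slotL (k t : ℕ) (ht : t < 4) : st (slotL k t) = t := by unfold st slotL; omega
/-- Occurrence of a unit label. [cite: GareyJohnsonStockmeyer1976, §2 (our explicit variant)] -/
@[simp] theorem ur_unitL (r s : ℕ) (hs : s < 2) : ur m (unitL m r s) = r := by unfold ur unitL; omega
/-- Side of a unit label. [cite: GareyJohnsonStockmeyer1976, §2 (our explicit variant)] -/
@[simp] theorem us_unitL (r s : ℕ) (hs : s < 2) : us m (unitL m r s) = s := by unfold us unitL; omega
/-- Clause of a gadget label. [cite: GareyJohnsonStockmeyer1976, §2 (our explicit variant)] -/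
@[simp] theorem gj_gadL (j t : ℕ) (ht : t < 6) : gj m (gadL m j t) = j := by unfold gj gadL; omega
/-- Node type of a gadget label. [cite: GareyJohnsonStockmeyer1976, §2 (our explicit variant)] -/
@[simp] theorem gt_gadL (j t : ℕ) (ht : t < 6) : gt m (gadL m j t) = t := by unfold gt gadL; omega

/-- `slotL` labels are slot labels. [cite: GareyJohnsonStockmeyer1976, §2 (our explicit variant)] -/
theorem isSlot_slotL {k t : ℕ} (hk : k < KS m) (ht : t < 4) : isSlot m (slotL k t) = true := by
  unfold isSlot slotL KS U0 at *; simp only [Bool.and_eq_true, decide_eq_true_eq]; omega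
/-- `unitL` labels are unit labels. [cite: GareyJohnsonStockmeyer1976, §2 (our explicit variant)] -/
theorem isUnit_unitL {r s : ℕ} (hr : r < 3 * m) (hs : s < 2) : isUnit m (unitL m r s) = true := by
  unfold isUnit unitL U0 G0 at *; simp only [Bool.and_eq_true, decide_eq_true_eq]; omega
/-- `gadL` labels are gadget labels. [cite: GareyJohnsonStockmeyer1976, §2 (our explicit variant)] -/
theorem isGad_gadL {j t : ℕ} (hj : j < m) (ht : t < 6) : isGad m (gadL m j t) = true := by
  unfold isGad gadL G0 nLab at *; simp only [Bool.and_eq_true, decide_eq_true_eq]; omega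

/-- A slot label is `slotL` of its coordinates. [cite: GareyJohnsonStockmeyer1976, §2 (our explicit variant)] -/
theorem eq_slotL_of_isSlot {a : ℕ} (h : isSlot m a = true) :
    a = slotL (sk a) (st a) ∧ sk a < KS m ∧ st a < 4 := by
  unfold isSlot at h; unfold slotL sk st KS; unfold U0 at h
  simp only [Bool.and_eq_true, decide_eq_true_eq] at h; omega

/-- A unit label is `unitL` of its coordinates. [cite: GareyJohnsonStockmeyer1976, Thm 2.1 (our explicit variant)] -/
theorem eq_unitL_of_isUnit {a : ℕ} (h : isUnit m a = true) :
    a = unitL m (ur m a) (us m a) ∧ ur m a < 3 * m ∧ us m a < 2 := by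
  unfold isUnit at h; unfold unitL ur us; unfold U0 G0 at *
  simp only [Bool.and_eq_true, decide_eq_true_eq] at h; omega

/-- A gadget label is `gadL` of its coordinates. [cite: GareyJohnsonStockmeyer1976, Thm 2.1 (OR-gadget)] -/
theorem eq_gadL_of_isGad {a : ℕ} (h : isGad m a = true) :
    a = gadL m (gj m a) (gt m a) ∧ gj m a < m ∧ gt m a < 6 := by
  unfold isGad at h; unfold gadL gj gt; unfold G0 nLab at *
  simp only [Bool.and_eq_true, decide_eq_true_eq] at h; omega

/-- Slot labels precede unit labels. [cite: GareyJohnsonStockmeyer1976, §2 (our explicit variant)] -/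
theorem slotL_lt_U0 {k t : ℕ} (hk : k < KS m) (ht : t < 4) : slotL k t < U0 m := by
  unfold slotL KS U0 at *; omega
/-- Unit labels start at `U0`. [cite: GareyJohnsonStockmeyer1976, §2 (our explicit variant)] -/
theorem U0_le_unitL (r s : ℕ) : U0 m ≤ unitL m r s := by unfold unitL; omega
/-- Unit labels precede gadget labels. [cite: GareyJohnsonStockmeyer1976, §2 (our explicit variant)] -/
theorem unitL_lt_G0 {r s : ℕ} (hr : r < 3 * m) (hs : s < 2) : unitL m r s < G0 m := by
  unfold unitL U0 G0 at *; omega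
/-- Gadget labels start at `G0`. [cite: GareyJohnsonStockmeyer1976, §2 (our explicit variant)] -/
theorem G0_le_gadL (j t : ℕ) : G0 m ≤ gadL m j t := by unfold gadL; omega
/-- Gadget labels are `< 32m + 9`. [cite: GareyJohnsonStockmeyer1976, §2 (our explicit variant)] -/
theorem gadL_lt_nLab {j t : ℕ} (hj : j < m) (ht : t < 6) : gadL m j t < nLab m := by
  unfold gadL G0 nLab at *; omega
/-- `U0 ≤ G0`. [cite: GareyJohnsonStockmeyer1976, §2 (our explicit variant)] -/
theorem U0_lt_G0_iff : U0 m ≤ G0 m := by unfold U0 G0; omega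
/-- The `F`-chain is nonempty. [cite: GareyJohnsonStockmeyer1976, §2 (our explicit variant)] -/
theorem KB_lt_KS : KB m < KS m := by unfold KB KS; omega

/-- `slotL` is injective. [cite: GareyJohnsonStockmeyer1976, §2 (our explicit variant)] -/
theorem slotL_injective {k t k' t' : ℕ} (ht : t < 4) (ht' : t' < 4) (h : slotL k t = slotL k' t') :
    k = k' ∧ t = t' := by unfold slotL at h; omega
/-- `unitL` is injective. [cite: GareyJohnsonStockmeyer1976, §2 (our explicit variant)] -/
theorem unitL_injective {r s r' s' : ℕ} (hs : s < 2) (hs' : s' < 2) (h : unitL m r s = unitL m r' s') :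
    r = r' ∧ s = s' := by unfold unitL at h; omega
/-- `gadL` is injective. [cite: GareyJohnsonStockmeyer1976, §2 (our explicit variant)] -/
theorem gadL_injective {j t j' t' : ℕ} (ht : t < 6) (ht' : t' < 6) (h : gadL m j t = gadL m j' t') :
    j = j' ∧ t = t' := by unfold gadL at h; omega

end Coord

/-! ### §4. The structural form of the edge test -/

section Structure

variable {m : ℕ} {var : ℕ → ℕ} {pol : ℕ → Bool}

/-- `noneBetween` unfolded. [cite: GareyJohnsonStockmeyer1976, §2 (our explicit variant)] -/
theorem noneBetween_iff (var : ℕ → ℕ) (r₀ r : ℕ) :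
    noneBetween var r₀ r = true ↔ ∀ i, r₀ < i → i < r → var i ≠ var r := by
  unfold noneBetween
  simp only [List.all_eq_true, List.mem_range, Bool.or_eq_true, decide_eq_true_eq, Bool.not_eq_true',
    decide_eq_false_iff_not]
  constructor
  · intro h i h1 h2
    rcases h i h2 with h3 | h3
    · omega
    · exact h3
  · intro h i hi
    by_cases h0 : i ≤ r₀
    · exact Or.inl h0
    · exact Or.inr (h i (by omega) hi)

/-- **The directed edges, structurally**: one constructor per rule, in coordinates.
[cite: BlaserDorflerIkenmeyer2020, Thm 22 (proof)] -/
inductive DirEdge (m : ℕ) (var : ℕ → ℕ) (pol : ℕ → Bool) : ℕ → ℕ → Prop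
  | diamond (k t t' : ℕ) (hk : k < KS m) (ht : t < 4) (ht' : t' < 4)
      (htt : (t = 0 ∧ (t' = 1 ∨ t' = 2)) ∨ (t = 1 ∧ (t' = 2 ∨ t' = 3)) ∨ (t = 2 ∧ t' = 3)) :
      DirEdge m var pol (slotL k t) (slotL k t')
  | chain (k t : ℕ) (hk : k + 1 < KS m) (hkB : k + 1 ≠ KB m) (ht : t = 1 ∨ t = 2) :
      DirEdge m var pol (slotL k t) (slotL (k + 1) 0)
  | pal₁ : DirEdge m var pol 0 (slotL 0 0)
  | pal₂ : DirEdge m var pol 0 (slotL (KB m) 0)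
  | pal₃ : DirEdge m var pol (slotL 0 0) (slotL (KB m) 0)
  | pair (r : ℕ) (hr : r < 3 * m) : DirEdge m var pol (unitL m r 0) (unitL m r 1)
  | anchor (r s : ℕ) (hr : r < 3 * m) (hs : s < 2) : DirEdge m var pol (unitL m r s) (slotL (1 + r) 3)
  | varChain (r₀ r : ℕ) (hr₀ : r₀ < r) (hr : r < 3 * m) (hv : var r₀ = var r)
      (hb : ∀ i, r₀ < i → i < r → var i ≠ var r) : DirEdge m var pol (unitL m r₀ 1) (unitL m r 0)
  | gadget (j t t' : ℕ) (hj : j < m) (ht : t < 6) (ht' : t' < 6)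
      (htt : (t = 0 ∧ (t' = 1 ∨ t' = 2)) ∨ (t = 1 ∧ t' = 2) ∨ (t = 2 ∧ t' = 3) ∨
        (t = 3 ∧ (t' = 4 ∨ t' = 5)) ∨ (t = 4 ∧ t' = 5)) :
      DirEdge m var pol (gadL m j t) (gadL m j t')
  | input (j t : ℕ) (hj : j < m) (ht : t = 0 ∨ t = 1 ∨ t = 4) :
      DirEdge m var pol (unitL m (3 * j + pos t) (if pol (3 * j + pos t) then 0 else 1)) (gadL m j t)
  | hubB (j : ℕ) (hj : j < m) : DirEdge m var pol (gadL m j 5) (slotL (1 + 3 * m + j) 3)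
  | hubF (j : ℕ) (hj : j < m) : DirEdge m var pol (gadL m j 5) (slotL (KB m + 1 + j) 3)

/-- **Inversion of the edge test.** [cite: BlaserDorflerIkenmeyer2020, Thm 22 (proof)] -/
theorem dirEdge_of_dirAdj {a b : ℕ} (h : dirAdj m var pol a b = true) : DirEdge m var pol a b := by
  unfold dirAdj at h
  simp only [Bool.or_eq_true] at h
  rcases h with (((((((h | h) | h) | h) | h) | h) | h) | h) | h
  · -- R1
    unfold R1 at h
    simp only [Bool.and_eq_true, Bool.or_eq_true, decide_eq_true_eq] at h
    obtain ⟨⟨⟨ha, hb⟩, hk⟩, htt⟩ := h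
    obtain ⟨ea, hka, hta⟩ := eq_slotL_of_isSlot m ha
    obtain ⟨eb, hkb, htb⟩ := eq_slotL_of_isSlot m hb
    rw [ea, eb, ← hk]
    exact DirEdge.diamond _ _ _ hka hta htb (or_assoc.mp htt)
  · -- R2
    unfold R2 at h
    simp only [Bool.and_eq_true, Bool.or_eq_true, Bool.not_eq_true', decide_eq_true_eq,
      decide_eq_false_iff_not] at h
    obtain ⟨⟨⟨⟨⟨ha, hb⟩, hk⟩, hkB⟩, hta'⟩, htb'⟩ := h
    obtain ⟨ea, hka, hta⟩ := eq_slotL_of_isSlot m ha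
    obtain ⟨eb, hkb, htb⟩ := eq_slotL_of_isSlot m hb
    rw [ea, eb, hk, htb']
    exact DirEdge.chain _ _ (hk ▸ hkb) (hk ▸ hkB) hta'
  · -- R3
    unfold R3 at h
    simp only [Bool.and_eq_true, Bool.or_eq_true, decide_eq_true_eq] at h
    rcases h with ⟨rfl, rfl | rfl⟩ | ⟨rfl, rfl⟩
    · exact DirEdge.pal₁
    · exact DirEdge.pal₂
    · exact DirEdge.pal₃
  · -- R4
    unfold R4 at h
    simp only [Bool.and_eq_true, decide_eq_true_eq] at h
    obtain ⟨⟨⟨⟨ha, hb⟩, hr⟩, hsa⟩, hsb⟩ := h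
    obtain ⟨ea, hra, -⟩ := eq_unitL_of_isUnit m ha
    obtain ⟨eb, -, -⟩ := eq_unitL_of_isUnit m hb
    rw [ea, eb, ← hr, hsa, hsb]
    exact DirEdge.pair _ hra
  · -- R5
    unfold R5 at h
    simp only [Bool.and_eq_true, decide_eq_true_eq] at h
    obtain ⟨⟨⟨ha, hb⟩, hk⟩, ht⟩ := h
    obtain ⟨ea, hra, hsa⟩ := eq_unitL_of_isUnit m ha
    obtain ⟨eb, -, -⟩ := eq_slotL_of_isSlot m hb
    rw [ea, eb, hk, ht]
    exact DirEdge.anchor _ _ hra hsa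
  · -- R6
    unfold R6 at h
    simp only [Bool.and_eq_true, decide_eq_true_eq] at h
    obtain ⟨⟨⟨⟨⟨⟨ha, hb⟩, hsa⟩, hsb⟩, hlt⟩, hv⟩, hnb⟩ := h
    obtain ⟨ea, -, -⟩ := eq_unitL_of_isUnit m ha
    obtain ⟨eb, hrb, -⟩ := eq_unitL_of_isUnit m hb
    rw [ea, eb, hsa, hsb]
    exact DirEdge.varChain _ _ hlt hrb hv ((noneBetween_iff var _ _).1 hnb)
  · -- R7
    unfold R7 at h
    simp only [Bool.and_eq_true, Bool.or_eq_true, decide_eq_true_eq] at h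
    obtain ⟨⟨⟨ha, hb⟩, hj⟩, htt⟩ := h
    obtain ⟨ea, hja, hta⟩ := eq_gadL_of_isGad m ha
    obtain ⟨eb, -, htb⟩ := eq_gadL_of_isGad m hb
    rw [ea, eb, ← hj]
    exact DirEdge.gadget _ _ _ hja hta htb (by
      rcases htt with (((h | h) | h) | h) | h
      exacts [Or.inl h, Or.inr (Or.inl h), Or.inr (Or.inr (Or.inl h)), Or.inr (Or.inr (Or.inr (Or.inl h))),
        Or.inr (Or.inr (Or.inr (Or.inr h)))])
  · -- R8
    unfold R8 at h
    simp only [Bool.and_eq_true, Bool.or_eq_true, decide_eq_true_eq] at h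
    obtain ⟨⟨⟨⟨ha, hb⟩, ht⟩, hr⟩, hs⟩ := h
    obtain ⟨ea, -, -⟩ := eq_unitL_of_isUnit m ha
    obtain ⟨eb, hjb, -⟩ := eq_gadL_of_isGad m hb
    rw [ea, eb, hs, hr]
    exact DirEdge.input _ _ hjb (or_assoc.mp ht)
  · -- R9
    unfold R9 at h
    simp only [Bool.and_eq_true, Bool.or_eq_true, decide_eq_true_eq] at h
    obtain ⟨⟨⟨⟨ha, hta⟩, hb⟩, htb⟩, hk⟩ := h
    obtain ⟨ea, hja, -⟩ := eq_gadL_of_isGad m ha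
    obtain ⟨eb, -, -⟩ := eq_slotL_of_isSlot m hb
    rw [ea, eb, hta, htb]
    rcases hk with hk | hk
    · rw [hk]; exact DirEdge.hubB _ hja
    · rw [hk]; exact DirEdge.hubF _ hja

/-- Every structural edge passes the edge test. [cite: BlaserDorflerIkenmeyer2020, Thm 22 (proof)] -/
theorem dirAdj_of_dirEdge {a b : ℕ} (h : DirEdge m var pol a b) : dirAdj m var pol a b = true := by
  have hKB : KB m < KS m := KB_lt_KS m
  have h0KS : 0 < KS m := by unfold KS; omega
  unfold dirAdj
  simp only [Bool.or_eq_true]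
  cases h with
  | diamond k t t' hk ht ht' htt =>
    refine Or.inl (Or.inl (Or.inl (Or.inl (Or.inl (Or.inl (Or.inl (Or.inl ?_)))))))
    unfold R1
    simp only [Bool.and_eq_true, Bool.or_eq_true, decide_eq_true_eq, isSlot_slotL m hk ht,
      isSlot_slotL m hk ht', sk_slotL _ _ ht, sk_slotL _ _ ht', st_slotL _ _ ht, st_slotL _ _ ht']
    exact ⟨⟨⟨trivial, trivial⟩, trivial⟩, or_assoc.mpr htt⟩
  | chain k t hk hkB ht =>
    refine Or.inl (Or.inl (Or.inl (Or.inl (Or.inl (Or.inl (Or.inl (Or.inr ?_)))))))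
    have ht4 : t < 4 := by omega
    unfold R2
    simp only [Bool.and_eq_true, Bool.or_eq_true, Bool.not_eq_true', decide_eq_true_eq,
      decide_eq_false_iff_not, isSlot_slotL m (show k < KS m by omega) ht4, isSlot_slotL m hk (show 0 < 4 by omega),
      sk_slotL _ _ ht4, sk_slotL _ _ (show 0 < 4 by omega), st_slotL _ _ ht4, st_slotL _ _ (show 0 < 4 by omega)]
    exact ⟨⟨⟨⟨⟨trivial, trivial⟩, trivial⟩, hkB⟩, ht⟩, trivial⟩
  | pal₁ =>
    refine Or.inl (Or.inl (Or.inl (Or.inl (Or.inl (Or.inl (Or.inr ?_))))))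
    unfold R3 slotL; simp
  | pal₂ =>
    refine Or.inl (Or.inl (Or.inl (Or.inl (Or.inl (Or.inl (Or.inr ?_))))))
    unfold R3; simp
  | pal₃ =>
    refine Or.inl (Or.inl (Or.inl (Or.inl (Or.inl (Or.inl (Or.inr ?_))))))
    unfold R3 slotL; simp
  | pair r hr =>
    refine Or.inl (Or.inl (Or.inl (Or.inl (Or.inl (Or.inr ?_)))))
    unfold R4
    simp [isUnit_unitL m hr, ur_unitL, us_unitL]
  | anchor r s hr hs =>
    refine Or.inl (Or.inl (Or.inl (Or.inl (Or.inr ?_))))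
    have hk : 1 + r < KS m := by unfold KS; omega
    unfold R5
    simp [isUnit_unitL m hr hs, isSlot_slotL m hk (show 3 < 4 by omega), ur_unitL m r s hs, sk_slotL,
      st_slotL]
  | varChain r₀ r hr₀ hr hv hb =>
    refine Or.inl (Or.inl (Or.inl (Or.inr ?_)))
    unfold R6
    simp only [Bool.and_eq_true, decide_eq_true_eq, isUnit_unitL m (show r₀ < 3 * m by omega) (show 1 < 2 by omega),
      isUnit_unitL m hr (show 0 < 2 by omega), ur_unitL m _ _ (show 1 < 2 by omega),
      ur_unitL m _ _ (show 0 < 2 by omega), us_unitL m _ _ (show 1 < 2 by omega),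
      us_unitL m _ _ (show 0 < 2 by omega), noneBetween_iff]
    exact ⟨⟨⟨⟨⟨⟨trivial, trivial⟩, trivial⟩, trivial⟩, hr₀⟩, hv⟩, hb⟩
  | gadget j t t' hj ht ht' htt =>
    refine Or.inl (Or.inl (Or.inr ?_))
    unfold R7
    simp only [Bool.and_eq_true, Bool.or_eq_true, decide_eq_true_eq, isGad_gadL m hj ht, isGad_gadL m hj ht',
      gj_gadL m _ _ ht, gj_gadL m _ _ ht', gt_gadL m _ _ ht, gt_gadL m _ _ ht']
    refine ⟨⟨⟨trivial, trivial⟩, trivial⟩, ?_⟩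
    rcases htt with h | h | h | h | h
    exacts [Or.inl (Or.inl (Or.inl (Or.inl h))), Or.inl (Or.inl (Or.inl (Or.inr h))), Or.inl (Or.inl (Or.inr h)),
      Or.inl (Or.inr h), Or.inr h]
  | input j t hj ht =>
    refine Or.inl (Or.inr ?_)
    have ht6 : t < 6 := by omega
    have hp : pos t < 3 := by unfold pos; split_ifs <;> omega
    have hr : 3 * j + pos t < 3 * m := by omega
    have hs : (if pol (3 * j + pos t) then 0 else 1) < 2 := by split_ifs <;> omega
    unfold R8
    simp only [Bool.and_eq_true, Bool.or_eq_true, decide_eq_true_eq, isUnit_unitL m hr hs, isGad_gadL m hj ht6,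
      gt_gadL m _ _ ht6, gj_gadL m _ _ ht6, ur_unitL m _ _ hs, us_unitL m _ _ hs]
    refine ⟨⟨⟨⟨trivial, trivial⟩, or_assoc.mpr ht⟩, ?_⟩, ?_⟩ <;> simp
  | hubB j hj =>
    refine Or.inr ?_
    have hk : 1 + 3 * m + j < KS m := by unfold KS; omega
    unfold R9
    simp [isGad_gadL m hj (show 5 < 6 by omega), isSlot_slotL m hk (show 3 < 4 by omega), gt_gadL, gj_gadL,
      sk_slotL, st_slotL]
  | hubF j hj =>
    refine Or.inr ?_
    have hk : KB m + 1 + j < KS m := by unfold KB KS; omega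
    unfold R9
    simp [isGad_gadL m hj (show 5 < 6 by omega), isSlot_slotL m hk (show 3 < 4 by omega), gt_gadL, gj_gadL,
      sk_slotL, st_slotL]

/-- `dirAdj` is exactly `DirEdge`. [cite: BlaserDorflerIkenmeyer2020, Thm 22 (proof)] -/
theorem dirAdj_iff {a b : ℕ} : dirAdj m var pol a b = true ↔ DirEdge m var pol a b :=
  ⟨dirEdge_of_dirAdj, dirAdj_of_dirEdge⟩

/-- Endpoints of an edge are labels `< 32m + 9`, and distinct. [cite: BlaserDorflerIkenmeyer2020, Thm 22 (proof)] -/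
theorem DirEdge.bounds {a b : ℕ} (h : DirEdge m var pol a b) : a < nLab m ∧ b < nLab m ∧ a ≠ b := by
  have hKB : KB m < KS m := KB_lt_KS m
  cases h with
  | diamond k t t' hk ht ht' htt => unfold slotL nLab; unfold KS at hk; omega
  | chain k t hk hkB ht => unfold slotL nLab; unfold KS at hk; omega
  | pal₁ => unfold slotL nLab; omega
  | pal₂ => unfold slotL nLab KB; omega
  | pal₃ => unfold slotL nLab KB; omega
  | pair r hr => unfold unitL nLab U0; omega
  | anchor r s hr hs => unfold unitL slotL nLab U0; omega
  | varChain r₀ r hr₀ hr hv hb => unfold unitL nLab U0; omega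
  | gadget j t t' hj ht ht' htt => unfold gadL nLab G0; omega
  | input j t hj ht =>
    have hp : pos t < 3 := by unfold pos; split_ifs <;> omega
    unfold unitL gadL nLab U0 G0; split_ifs <;> omega
  | hubB j hj => unfold gadL slotL nLab G0; omega
  | hubF j hj => unfold gadL slotL nLab G0 KB; omega

/-- `adj` only relates labels `< 32m + 9`. [cite: BlaserDorflerIkenmeyer2020, Thm 22 (proof)] -/
theorem lt_of_adj {a b : ℕ} (h : adj m var pol a b = true) : a < nLab m ∧ b < nLab m ∧ a ≠ b := by
  rw [adj, Bool.or_eq_true] at h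
  rcases h with h | h
  · exact (dirEdge_of_dirAdj h).bounds
  · obtain ⟨h1, h2, h3⟩ := (dirEdge_of_dirAdj h).bounds; exact ⟨h2, h1, Ne.symm h3⟩

end Structure

/-! ### §5. Previous and next occurrence of a variable -/

section Occurrences

variable (var : ℕ → ℕ) (v : ℕ)

/-- The last occurrence `< n` of the variable `v`. [cite: GareyJohnsonStockmeyer1976, §2 (our explicit variant)] -/
def lastOcc : ℕ → Option ℕ
  | 0 => none
  | n + 1 => if var n = v then some n else lastOcc n

/-- The first occurrence of `v` in `[i₀, i₀ + f)`. [cite: GareyJohnsonStockmeyer1976, §2 (our explicit variant)] -/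
def firstOcc : ℕ → ℕ → Option ℕ
  | _, 0 => none
  | i₀, f + 1 => if var i₀ = v then some i₀ else firstOcc (i₀ + 1) f

/-- A list with at most one element, from an optional value. [folklore] -/
def optList (o : Option ℕ) (f : ℕ → ℕ) : List ℕ := match o with | some r => [f r] | none => []

/-- `optList` has length `≤ 1`. [cite: GareyJohnsonStockmeyer1976, §2 (our explicit variant: at most one chain neighbour)] -/
theorem length_optList_le (o : Option ℕ) (f : ℕ → ℕ) : (optList o f).length ≤ 1 := by
  cases o <;> simp [optList]

/-- Specification of `lastOcc`. [cite: GareyJohnsonStockmeyer1976, §2 (our explicit variant)] -/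
theorem lastOcc_eq_some_iff (n i : ℕ) :
    lastOcc var v n = some i ↔ i < n ∧ var i = v ∧ ∀ i', i < i' → i' < n → var i' ≠ v := by
  induction n generalizing i with
  | zero => simp [lastOcc]
  | succ n ih =>
    unfold lastOcc
    by_cases h : var n = v
    · rw [if_pos h]
      constructor
      · rintro ⟨rfl⟩
        exact ⟨Nat.lt_succ_self _, h, fun i' h1 h2 => by omega⟩
      · rintro ⟨h1, h2, h3⟩
        have : ¬ i < n := fun hlt => h3 n hlt (Nat.lt_succ_self _) h
        have : i = n := by omega
        rw [this]
    · rw [if_neg h, ih]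
      constructor
      · rintro ⟨h1, h2, h3⟩
        refine ⟨by omega, h2, fun i' h4 h5 => ?_⟩
        by_cases h6 : i' = n
        · rw [h6]; exact h
        · exact h3 i' h4 (by omega)
      · rintro ⟨h1, h2, h3⟩
        have hin : i ≠ n := fun h' => h (h' ▸ h2)
        exact ⟨by omega, h2, fun i' h4 h5 => h3 i' h4 (by omega)⟩

/-- Specification of `firstOcc`. [cite: GareyJohnsonStockmeyer1976, §2 (our explicit variant)] -/
theorem firstOcc_eq_some_iff (f i₀ i : ℕ) :
    firstOcc var v i₀ f = some i ↔ i₀ ≤ i ∧ i < i₀ + f ∧ var i = v ∧ ∀ i', i₀ ≤ i' → i' < i → var i' ≠ v := by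
  induction f generalizing i₀ i with
  | zero =>
    constructor
    · intro h; simp [firstOcc] at h
    · rintro ⟨h1, h2, -, -⟩; omega
  | succ f ih =>
    unfold firstOcc
    by_cases h : var i₀ = v
    · rw [if_pos h]
      constructor
      · rintro ⟨rfl⟩
        exact ⟨le_rfl, by omega, h, fun i' h1 h2 => by omega⟩
      · rintro ⟨h1, h2, h3, h4⟩
        have : ¬ i₀ < i := fun hlt => h4 i₀ le_rfl hlt h
        have : i = i₀ := by omega
        rw [this]
    · rw [if_neg h, ih]
      constructor
      · rintro ⟨h1, h2, h3, h4⟩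
        refine ⟨by omega, by omega, h3, fun i' h5 h6 => ?_⟩
        by_cases h7 : i' = i₀
        · rw [h7]; exact h
        · exact h4 i' (by omega) h6
      · rintro ⟨h1, h2, h3, h4⟩
        have hin : i ≠ i₀ := fun h' => h (h' ▸ h3)
        exact ⟨by omega, by omega, h3, fun i' h5 h6 => h4 i' (by omega) h6⟩

/-- An occurring variable has a last occurrence. [cite: GareyJohnsonStockmeyer1976, §2 (our explicit variant)] -/
theorem lastOcc_isSome {n : ℕ} (h : ∃ i, i < n ∧ var i = v) : ∃ r₀, lastOcc var v n = some r₀ := by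
  induction n with
  | zero => obtain ⟨i, hi, -⟩ := h; omega
  | succ n ih =>
    unfold lastOcc
    by_cases hv : var n = v
    · exact ⟨n, by rw [if_pos hv]⟩
    · rw [if_neg hv]
      obtain ⟨i, hi, hiv⟩ := h
      have hin : i ≠ n := fun h' => hv (h' ▸ hiv)
      exact ih ⟨i, by omega, hiv⟩

end Occurrences

/-! ### §6. Every label has at most four neighbours -/

section Degree

variable (m : ℕ) (var : ℕ → ℕ) (pol : ℕ → Bool)

/-- The port vertex of occurrence `r`: `a_r` if the literal is positive, `b_r` otherwise.
[cite: GareyJohnsonStockmeyer1976, Thm 2.1 (OR-gadget inputs are the literal vertices)] -/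
def port (r : ℕ) : ℕ := unitL m r (if pol r then 0 else 1)

/-- The gadget node fed by position `p` (`0 ↦ g₁`, `1 ↦ g₂`, `2 ↦ h₂`). [cite: GareyJohnsonStockmeyer1976, Thm 2.1 (OR-gadget)] -/
def gnode (p : ℕ) : ℕ := if p = 2 then 4 else p

/-- **Candidate neighbours** of a label (at most four). [cite: GareyJohnsonStockmeyer1976, §2 (maximum degree 4)] -/
def nbrs (a : ℕ) : List ℕ :=
  if a = 0 then [slotL 0 0, slotL (KB m) 0]
  else if a < U0 m then
    (if st a = 0 then
      [slotL (sk a) 1, slotL (sk a) 2] ++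
        (if sk a = 0 then [0, slotL (KB m) 0]
          else if sk a = KB m then [0, slotL 0 0]
          else [slotL (sk a - 1) 1, slotL (sk a - 1) 2])
    else if st a = 3 then
      [slotL (sk a) 1, slotL (sk a) 2] ++
        (if 1 ≤ sk a ∧ sk a ≤ 3 * m then [unitL m (sk a - 1) 0, unitL m (sk a - 1) 1]
          else if 1 + 3 * m ≤ sk a ∧ sk a < KB m then [gadL m (sk a - 1 - 3 * m) 5]
          else if KB m + 1 ≤ sk a then [gadL m (sk a - KB m - 1) 5] else [])
    else [slotL (sk a) 0, slotL (sk a) (3 - st a), slotL (sk a) 3, slotL (sk a + 1) 0])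
  else if a < G0 m then
    [unitL m (ur m a) (1 - us m a), slotL (1 + ur m a) 3, gadL m (ur m a / 3) (gnode (ur m a % 3))] ++
      (if us m a = 0 then optList (lastOcc var (var (ur m a)) (ur m a)) (fun r₀ => unitL m r₀ 1)
      else optList (firstOcc var (var (ur m a)) (ur m a + 1) (3 * m - (ur m a + 1))) (fun r₁ => unitL m r₁ 0))
  else if a < nLab m then
    (if gt m a = 0 then [gadL m (gj m a) 1, gadL m (gj m a) 2, port m pol (3 * gj m a)]
    else if gt m a = 1 then [gadL m (gj m a) 0, gadL m (gj m a) 2, port m pol (3 * gj m a + 1)]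
    else if gt m a = 2 then [gadL m (gj m a) 0, gadL m (gj m a) 1, gadL m (gj m a) 3]
    else if gt m a = 3 then [gadL m (gj m a) 2, gadL m (gj m a) 4, gadL m (gj m a) 5]
    else if gt m a = 4 then [gadL m (gj m a) 3, gadL m (gj m a) 5, port m pol (3 * gj m a + 2)]
    else [gadL m (gj m a) 3, gadL m (gj m a) 4, slotL (1 + 3 * m + gj m a) 3, slotL (KB m + 1 + gj m a) 3])
  else []

/-- At most four candidates. [cite: GareyJohnsonStockmeyer1976, §2 (maximum degree 4)] -/
theorem length_nbrs_le (a : ℕ) : (nbrs m var pol a).length ≤ 4 := by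
  have h1 := length_optList_le (lastOcc var (var (ur m a)) (ur m a)) (fun r₀ => unitL m r₀ 1)
  have h2 := length_optList_le (firstOcc var (var (ur m a)) (ur m a + 1) (3 * m - (ur m a + 1)))
    (fun r₁ => unitL m r₁ 0)
  unfold nbrs
  split_ifs <;> simp only [List.length_cons, List.length_nil, List.length_append] <;> omega

variable {m var pol}

/-- The candidate list of a slot label. [cite: GareyJohnsonStockmeyer1976, §2 (our explicit variant)] -/
theorem nbrs_slotL {k t : ℕ} (hk : k < KS m) (ht : t < 4) :
    nbrs m var pol (slotL k t) =
      (if t = 0 then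
        [slotL k 1, slotL k 2] ++
          (if k = 0 then [0, slotL (KB m) 0]
            else if k = KB m then [0, slotL 0 0]
            else [slotL (k - 1) 1, slotL (k - 1) 2])
      else if t = 3 then
        [slotL k 1, slotL k 2] ++
          (if 1 ≤ k ∧ k ≤ 3 * m then [unitL m (k - 1) 0, unitL m (k - 1) 1]
            else if 1 + 3 * m ≤ k ∧ k < KB m then [gadL m (k - 1 - 3 * m) 5]
            else if KB m + 1 ≤ k then [gadL m (k - KB m - 1) 5] else [])
      else [slotL k 0, slotL k (3 - t), slotL k 3, slotL (k + 1) 0]) := by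
  have h0 : slotL k t ≠ 0 := by unfold slotL; omega
  have h1 : slotL k t < U0 m := slotL_lt_U0 m hk ht
  unfold nbrs
  rw [if_neg h0, if_pos h1, sk_slotL _ _ ht, st_slotL _ _ ht]

/-- The candidate list of a unit label. [cite: GareyJohnsonStockmeyer1976, Thm 2.1 (our explicit variant)] -/
theorem nbrs_unitL {r s : ℕ} (hr : r < 3 * m) (hs : s < 2) :
    nbrs m var pol (unitL m r s) =
      [unitL m r (1 - s), slotL (1 + r) 3, gadL m (r / 3) (gnode (r % 3))] ++
        (if s = 0 then optList (lastOcc var (var r) r) (fun r₀ => unitL m r₀ 1)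
        else optList (firstOcc var (var r) (r + 1) (3 * m - (r + 1))) (fun r₁ => unitL m r₁ 0)) := by
  have h0 : unitL m r s ≠ 0 := by unfold unitL U0; omega
  have h1 : ¬ unitL m r s < U0 m := Nat.not_lt.2 (U0_le_unitL m r s)
  have h2 : unitL m r s < G0 m := unitL_lt_G0 m hr hs
  unfold nbrs
  rw [if_neg h0, if_neg h1, if_pos h2, ur_unitL m _ _ hs, us_unitL m _ _ hs]

/-- The candidate list of a gadget label. [cite: GareyJohnsonStockmeyer1976, Thm 2.1 (OR-gadget)] -/
theorem nbrs_gadL {j t : ℕ} (hj : j < m) (ht : t < 6) :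
    nbrs m var pol (gadL m j t) =
      (if t = 0 then [gadL m j 1, gadL m j 2, port m pol (3 * j)]
      else if t = 1 then [gadL m j 0, gadL m j 2, port m pol (3 * j + 1)]
      else if t = 2 then [gadL m j 0, gadL m j 1, gadL m j 3]
      else if t = 3 then [gadL m j 2, gadL m j 4, gadL m j 5]
      else if t = 4 then [gadL m j 3, gadL m j 5, port m pol (3 * j + 2)]
      else [gadL m j 3, gadL m j 4, slotL (1 + 3 * m + j) 3, slotL (KB m + 1 + j) 3]) := by
  have h0 : gadL m j t ≠ 0 := by unfold gadL G0; omega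
  have h1 : ¬ gadL m j t < U0 m := by have := G0_le_gadL m j t; have := U0_lt_G0_iff m; omega
  have h2 : ¬ gadL m j t < G0 m := Nat.not_lt.2 (G0_le_gadL m j t)
  have h3 : gadL m j t < nLab m := gadL_lt_nLab m hj ht
  unfold nbrs
  rw [if_neg h0, if_neg h1, if_neg h2, if_pos h3, gj_gadL m _ _ ht, gt_gadL m _ _ ht]

/-- **Every (directed) edge at `a` ends in a candidate**, first orientation.
[cite: GareyJohnsonStockmeyer1976, §2 (maximum degree 4)] -/
theorem mem_nbrs_of_dirEdge {a b : ℕ} (h : DirEdge m var pol a b) : b ∈ nbrs m var pol a := by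
  have hKB : KB m < KS m := KB_lt_KS m
  cases h with
  | diamond k t t' hk ht ht' htt =>
    rw [nbrs_slotL hk ht]
    rcases htt with ⟨rfl, rfl | rfl⟩ | ⟨rfl, rfl | rfl⟩ | ⟨rfl, rfl⟩ <;> simp
  | chain k t hk hkB ht =>
    have ht4 : t < 4 := by omega
    rw [nbrs_slotL (by omega) ht4]
    rcases ht with rfl | rfl <;> simp
  | pal₁ => unfold nbrs; simp
  | pal₂ => unfold nbrs; simp
  | pal₃ =>
    rw [nbrs_slotL (by unfold KS; omega) (by omega)]
    simp
  | pair r hr => rw [nbrs_unitL hr (by omega)]; simp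
  | anchor r s hr hs => rw [nbrs_unitL hr hs]; simp
  | varChain r₀ r hr₀ hr hv hb =>
    rw [nbrs_unitL (by omega) (by omega)]
    have hf : firstOcc var (var r₀) (r₀ + 1) (3 * m - (r₀ + 1)) = some r := by
      rw [firstOcc_eq_some_iff]
      exact ⟨by omega, by omega, hv.symm, fun i' h1 h2 => hv ▸ hb i' (by omega) h2⟩
    simp [hf, optList]
  | gadget j t t' hj ht ht' htt =>
    rw [nbrs_gadL hj ht]
    rcases htt with ⟨rfl, rfl | rfl⟩ | ⟨rfl, rfl⟩ | ⟨rfl, rfl⟩ | ⟨rfl, rfl | rfl⟩ | ⟨rfl, rfl⟩ <;> simp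
  | input j t hj ht =>
    have hp : pos t < 3 := by unfold pos; split_ifs <;> omega
    have hs : (if pol (3 * j + pos t) then 0 else 1) < 2 := by split_ifs <;> omega
    have hq : (3 * j + pos t) / 3 = j := by omega
    have hmod : (3 * j + pos t) % 3 = pos t := by omega
    have hg : gnode (pos t) = t := by
      unfold gnode pos; rcases ht with rfl | rfl | rfl <;> simp
    rw [nbrs_unitL (by omega) hs, hq, hmod, hg]
    simp
  | hubB j hj => rw [nbrs_gadL hj (by omega)]; simp
  | hubF j hj => rw [nbrs_gadL hj (by omega)]; simp

/-- **Every (directed) edge at `a` ends in a candidate**, second orientation.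
[cite: GareyJohnsonStockmeyer1976, §2 (maximum degree 4)] -/
theorem mem_nbrs_of_dirEdge' {a b : ℕ} (h : DirEdge m var pol b a) : b ∈ nbrs m var pol a := by
  have hKB : KB m < KS m := KB_lt_KS m
  cases h with
  | diamond k t t' hk ht ht' htt =>
    rw [nbrs_slotL hk ht']
    rcases htt with ⟨rfl, rfl | rfl⟩ | ⟨rfl, rfl | rfl⟩ | ⟨rfl, rfl⟩ <;> simp
  | chain k t hk hkB ht =>
    rw [nbrs_slotL hk (by omega)]
    rcases ht with rfl | rfl <;> simp [hkB]
  | pal₁ => rw [nbrs_slotL (by unfold KS; omega) (by omega)]; simp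
  | pal₂ =>
    rw [nbrs_slotL hKB (by omega)]
    have h1 : KB m ≠ 0 := by unfold KB; omega
    simp [h1]
  | pal₃ =>
    rw [nbrs_slotL hKB (by omega)]
    have h1 : KB m ≠ 0 := by unfold KB; omega
    simp [h1]
  | pair r hr => rw [nbrs_unitL hr (by omega)]; simp
  | anchor r s hr hs =>
    rw [nbrs_slotL (by unfold KS; omega) (by omega)]
    have h1 : 1 ≤ 1 + r ∧ 1 + r ≤ 3 * m := by omega
    simp only [if_pos h1, show (3 : ℕ) ≠ 0 by omega, if_false, if_true, List.mem_append, List.mem_cons,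
      List.not_mem_nil, or_false, Nat.add_sub_cancel_left]
    rcases (show s = 0 ∨ s = 1 by omega) with rfl | rfl <;> simp
  | varChain r₀ r hr₀ hr hv hb =>
    rw [nbrs_unitL hr (by omega)]
    have hl : lastOcc var (var r) r = some r₀ := by
      rw [lastOcc_eq_some_iff]; exact ⟨hr₀, hv, hb⟩
    simp [hl, optList]
  | gadget j t t' hj ht ht' htt =>
    rw [nbrs_gadL hj ht']
    rcases htt with ⟨rfl, rfl | rfl⟩ | ⟨rfl, rfl⟩ | ⟨rfl, rfl⟩ | ⟨rfl, rfl | rfl⟩ | ⟨rfl, rfl⟩ <;> simp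
  | input j t hj ht =>
    rw [nbrs_gadL hj (by omega)]
    unfold port
    rcases ht with rfl | rfl | rfl <;> simp [pos]
  | hubB j hj =>
    rw [nbrs_slotL (by unfold KS; omega) (by omega)]
    have h1 : ¬ (1 ≤ 1 + 3 * m + j ∧ 1 + 3 * m + j ≤ 3 * m) := by omega
    have h2 : 1 + 3 * m ≤ 1 + 3 * m + j ∧ 1 + 3 * m + j < KB m := by unfold KB; omega
    have h3 : 1 + 3 * m + j - 1 - 3 * m = j := by omega
    simp [h1, h2, h3]
  | hubF j hj =>
    rw [nbrs_slotL (by unfold KB KS; omega) (by omega)]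
    have h1 : ¬ (1 ≤ KB m + 1 + j ∧ KB m + 1 + j ≤ 3 * m) := by unfold KB; omega
    have h2 : ¬ (1 + 3 * m ≤ KB m + 1 + j ∧ KB m + 1 + j < KB m) := by omega
    have h3 : KB m + 1 ≤ KB m + 1 + j := by omega
    have h4 : KB m + 1 + j - KB m - 1 = j := by omega
    simp [h1, h2, h3, h4]

/-- Disjoint filters add up inside a common filter. [folklore] -/
private theorem length_filter_add_of_disjoint (L : List ℕ) (p q : ℕ → Bool)
    (h : ∀ b, p b = true → q b = true → False) :
    (L.filter p).length + (L.filter q).length = (L.filter fun b => p b || q b).length := by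
  induction L with
  | nil => simp
  | cons x L ih =>
    cases hp : p x <;> cases hq : q x
    · simp [hp, hq, ih]
    · simp [hp, hq]; omega
    · simp [hp, hq]; omega
    · exact (h x hp hq).elim

variable (m var pol)

/-- **Every label lies on at most four edges of `G_φ`** (maximum degree `4`, the class the printed
proof starts from: "a graph of maximum degree at most 4 [GJS76]").
[cite: GareyJohnsonStockmeyer1976, §2 (graph 3-colourability with no vertex degree exceeding 4)]
[cite: BlaserDorflerIkenmeyer2020, Thm 22 (proof), arXiv p0017.txt:L25] -/
theorem edgeDeg_adj_le (N a : ℕ) : edgeDeg N (adj m var pol) a ≤ 4 := by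
  unfold edgeDeg upNbrs downNbrs
  rw [length_filter_add_of_disjoint]
  · refine le_trans ?_ (length_nbrs_le m var pol a)
    apply List.Subperm.length_le
    apply List.subperm_of_subset ((List.nodup_range).filter _)
    intro b hb
    rw [List.mem_filter] at hb
    have h := hb.2
    unfold pairTest adj at h
    simp only [Bool.or_eq_true, Bool.and_eq_true, decide_eq_true_eq] at h
    rcases h with ⟨-, h | h⟩ | ⟨-, h | h⟩
    · exact mem_nbrs_of_dirEdge (dirEdge_of_dirAdj h)
    · exact mem_nbrs_of_dirEdge' (dirEdge_of_dirAdj h)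
    · exact mem_nbrs_of_dirEdge' (dirEdge_of_dirAdj h)
    · exact mem_nbrs_of_dirEdge (dirEdge_of_dirAdj h)
  · intro b hp hq
    unfold pairTest at hp hq
    simp only [Bool.and_eq_true, decide_eq_true_eq] at hp hq
    omega

end Degree

/-! ### §7. A satisfying assignment colours `G_φ` properly -/

section Completeness

variable (m : ℕ) (var : ℕ → ℕ) (pol : ℕ → Bool) (σ : ℕ → Bool)

/-- "the literal of occurrence `r` is true under `σ`" (`σ (var r) = pol r`). [cite: GareyJohnsonStockmeyer1976, Thm 2.1] -/
def litT (r : ℕ) : Bool := σ (var r) == pol r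

/-- Colours of a Garey–Johnson OR-gadget `(in₁, in₂, out) = (0, 1, 2)` on inputs "true?" `p`, `q`
(palette `B = 0`, `T = 1`, `F = 2`): the output is `T` iff `p ∨ q`. [cite: GareyJohnsonStockmeyer1976, Thm 2.1 (OR-gadget colouring)] -/
def orGad (p q : Bool) (t : ℕ) : ℕ :=
  if p then (if t = 0 then 2 else if t = 1 then 0 else 1)
  else if q then (if t = 0 then 0 else if t = 1 then 2 else 1)
  else (if t = 0 then 1 else if t = 1 then 0 else 2)

/-- Colours of the clause gadget `g₁ g₂ o h₁ h₂ out` on inputs `p₁ p₂ p₃`. [cite: GareyJohnsonStockmeyer1976, Thm 2.1 (two nested OR-gadgets)] -/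
def gadCol (p₁ p₂ p₃ : Bool) (t : ℕ) : ℕ :=
  if t < 3 then orGad p₁ p₂ t else orGad (p₁ || p₂) p₃ (t - 3)

/-- **The colouring of `G_φ` induced by an assignment `σ`** (`B = 0`, `T = 1`, `F = 2`).
[cite: GareyJohnsonStockmeyer1976, Thm 2.1 (proof, "if" direction)] -/
def col (a : ℕ) : ℕ :=
  if a = 0 then 1
  else if a < U0 m then
    (if sk a < KB m then (if st a = 1 then 1 else if st a = 2 then 2 else 0)
      else (if st a = 1 then 1 else if st a = 2 then 0 else 2))
  else if a < G0 m then (if (us m a = 0 ↔ σ (var (ur m a)) = true) then 1 else 2)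
  else if a < nLab m then
    gadCol (litT var pol σ (3 * gj m a)) (litT var pol σ (3 * gj m a + 1)) (litT var pol σ (3 * gj m a + 2)) (gt m a)
  else 0

variable {m var pol σ}

/-- All colours are `< 3`. [cite: GareyJohnsonStockmeyer1976, Thm 2.1] -/
theorem col_lt (a : ℕ) : col m var pol σ a < 3 := by
  unfold col gadCol orGad
  split_ifs <;> omega

/-- The colour of `T₀`. [cite: GareyJohnsonStockmeyer1976, Thm 2.1] -/
theorem col_zero : col m var pol σ 0 = 1 := by simp [col]

/-- The colours of the slots. [cite: GareyJohnsonStockmeyer1976, §2 (our explicit variant)] -/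
theorem col_slotL {k t : ℕ} (hk : k < KS m) (ht : t < 4) :
    col m var pol σ (slotL k t) =
      if k < KB m then (if t = 1 then 1 else if t = 2 then 2 else 0)
      else (if t = 1 then 1 else if t = 2 then 0 else 2) := by
  have h0 : slotL k t ≠ 0 := by unfold slotL; omega
  have h1 : slotL k t < U0 m := slotL_lt_U0 m hk ht
  unfold col
  rw [if_neg h0, if_pos h1, sk_slotL _ _ ht, st_slotL _ _ ht]

/-- The colours of the units. [cite: GareyJohnsonStockmeyer1976, Thm 2.1] -/
theorem col_unitL {r s : ℕ} (hr : r < 3 * m) (hs : s < 2) :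
    col m var pol σ (unitL m r s) = if (s = 0 ↔ σ (var r) = true) then 1 else 2 := by
  have h0 : unitL m r s ≠ 0 := by unfold unitL U0; omega
  have h1 : ¬ unitL m r s < U0 m := Nat.not_lt.2 (U0_le_unitL m r s)
  have h2 : unitL m r s < G0 m := unitL_lt_G0 m hr hs
  unfold col
  rw [if_neg h0, if_neg h1, if_pos h2, ur_unitL m _ _ hs, us_unitL m _ _ hs]

/-- The colours of the gadgets. [cite: GareyJohnsonStockmeyer1976, Thm 2.1 (OR-gadget)] -/
theorem col_gadL {j t : ℕ} (hj : j < m) (ht : t < 6) :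
    col m var pol σ (gadL m j t) =
      gadCol (litT var pol σ (3 * j)) (litT var pol σ (3 * j + 1)) (litT var pol σ (3 * j + 2)) t := by
  have h0 : gadL m j t ≠ 0 := by unfold gadL G0; omega
  have h1 : ¬ gadL m j t < U0 m := by have := G0_le_gadL m j t; have := U0_lt_G0_iff m; omega
  have h2 : ¬ gadL m j t < G0 m := Nat.not_lt.2 (G0_le_gadL m j t)
  have h3 : gadL m j t < nLab m := gadL_lt_nLab m hj ht
  unfold col
  rw [if_neg h0, if_neg h1, if_neg h2, if_pos h3, gj_gadL m _ _ ht, gt_gadL m _ _ ht]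

/-- The port vertex of `r` is coloured `T` iff the literal of `r` is true. [cite: GareyJohnsonStockmeyer1976, Thm 2.1] -/
theorem col_port {r : ℕ} (hr : r < 3 * m) :
    col m var pol σ (port m pol r) = if litT var pol σ r then 1 else 2 := by
  unfold port litT
  have hs : (if pol r then 0 else 1) < 2 := by split_ifs <;> omega
  rw [col_unitL hr hs]
  cases hp : pol r <;> cases hσ : σ (var r) <;> simp

/-- **The induced colouring is proper** when `σ` satisfies every clause.
[cite: GareyJohnsonStockmeyer1976, Thm 2.1 (proof, "if" direction)] -/
theorem col_ne_of_dirEdge (hsat : ∀ j, j < m → litT var pol σ (3 * j) = true ∨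
      litT var pol σ (3 * j + 1) = true ∨ litT var pol σ (3 * j + 2) = true)
    {a b : ℕ} (h : DirEdge m var pol a b) : col m var pol σ a ≠ col m var pol σ b := by
  have hKB : KB m < KS m := KB_lt_KS m
  cases h with
  | diamond k t t' hk ht ht' htt =>
    rw [col_slotL hk ht, col_slotL hk ht']
    rcases htt with ⟨rfl, rfl | rfl⟩ | ⟨rfl, rfl | rfl⟩ | ⟨rfl, rfl⟩ <;> split_ifs <;>
      first | contradiction | omega
  | chain k t hk hkB ht =>
    rw [col_slotL (show k < KS m by omega) (show t < 4 by omega), col_slotL hk (show 0 < 4 by omega)]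
    have hiff : k < KB m ↔ k + 1 < KB m := by omega
    rcases ht with rfl | rfl <;> split_ifs <;> first | contradiction | omega
  | pal₁ => rw [col_zero, col_slotL (by omega) (by omega)]; simp [show 0 < KB m by unfold KB; omega]
  | pal₂ => rw [col_zero, col_slotL hKB (by omega)]; simp
  | pal₃ => rw [col_slotL (by omega) (by omega), col_slotL hKB (by omega)]; simp [show 0 < KB m by unfold KB; omega]
  | pair r hr =>
    rw [col_unitL hr (by omega), col_unitL hr (by omega)]
    cases σ (var r) <;> simp
  | anchor r s hr hs =>
    rw [col_unitL hr hs, col_slotL (by unfold KS; omega) (by omega)]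
    have hk : 1 + r < KB m := by unfold KB; omega
    simp only [if_pos hk]
    split_ifs <;> first | contradiction | omega
  | varChain r₀ r hr₀ hr hv hb =>
    rw [col_unitL (by omega) (by omega), col_unitL hr (by omega), hv]
    cases σ (var r) <;> simp
  | gadget j t t' hj ht ht' htt =>
    rw [col_gadL hj ht, col_gadL hj ht']
    generalize litT var pol σ (3 * j) = p₁
    generalize litT var pol σ (3 * j + 1) = p₂
    generalize litT var pol σ (3 * j + 2) = p₃
    rcases htt with ⟨rfl, rfl | rfl⟩ | ⟨rfl, rfl⟩ | ⟨rfl, rfl⟩ | ⟨rfl, rfl | rfl⟩ | ⟨rfl, rfl⟩ <;>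
      cases p₁ <;> cases p₂ <;> cases p₃ <;> decide
  | input j t hj ht =>
    have hp : pos t < 3 := by unfold pos; split_ifs <;> omega
    have ht6 : t < 6 := by omega
    have hport : unitL m (3 * j + pos t) (if pol (3 * j + pos t) then 0 else 1) = port m pol (3 * j + pos t) := rfl
    rw [hport, col_port (by omega), col_gadL hj ht6]
    rcases ht with rfl | rfl | rfl
    · rw [show pos 0 = 0 by simp [pos], Nat.add_zero]
      generalize litT var pol σ (3 * j) = p₁
      generalize litT var pol σ (3 * j + 1) = p₂
      generalize litT var pol σ (3 * j + 2) = p₃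
      cases p₁ <;> cases p₂ <;> cases p₃ <;> decide
    · rw [show pos 1 = 1 by simp [pos]]
      generalize litT var pol σ (3 * j) = p₁
      generalize litT var pol σ (3 * j + 1) = p₂
      generalize litT var pol σ (3 * j + 2) = p₃
      cases p₁ <;> cases p₂ <;> cases p₃ <;> decide
    · rw [show pos 4 = 2 by simp [pos]]
      generalize litT var pol σ (3 * j) = p₁
      generalize litT var pol σ (3 * j + 1) = p₂
      generalize litT var pol σ (3 * j + 2) = p₃
      cases p₁ <;> cases p₂ <;> cases p₃ <;> decide
  | hubB j hj =>
    rw [col_gadL hj (by omega), col_slotL (by unfold KS; omega) (by omega)]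
    have hk : 1 + 3 * m + j < KB m := by unfold KB; omega
    simp only [if_pos hk]
    generalize litT var pol σ (3 * j) = p₁
    generalize litT var pol σ (3 * j + 1) = p₂
    generalize litT var pol σ (3 * j + 2) = p₃
    cases p₁ <;> cases p₂ <;> cases p₃ <;> decide
  | hubF j hj =>
    rw [col_gadL hj (by omega), col_slotL (by unfold KB KS; omega) (by omega)]
    have hk : ¬ KB m + 1 + j < KB m := by omega
    simp only [if_neg hk]
    have hj' := hsat j hj
    generalize litT var pol σ (3 * j) = p₁ at hj' ⊢
    generalize litT var pol σ (3 * j + 1) = p₂ at hj' ⊢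
    generalize litT var pol σ (3 * j + 2) = p₃ at hj' ⊢
    cases p₁ <;> cases p₂ <;> cases p₃ <;> simp at hj' <;> decide

/-- **Completeness**: a satisfying assignment yields a proper `3`-colouring of `G_φ` (in the form
produced by `BDI20NPHard.hwvEvalWaring_graphTableau_ne_zero_iff_coloring`).
[cite: GareyJohnsonStockmeyer1976, Thm 2.1 (proof, "if" direction)] -/
theorem exists_proper_of_sat (hsat : ∀ j, j < m → litT var pol σ (3 * j) = true ∨
      litT var pol σ (3 * j + 1) = true ∨ litT var pol σ (3 * j + 2) = true) :
    ∃ c : ℕ → ℕ, (∀ a, c a < 3) ∧ ∀ a b, a < nLab m → b < nLab m →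
      pairTest (adj m var pol) a b = true → c a ≠ c b := by
  refine ⟨col m var pol σ, col_lt, fun a b _ _ h => ?_⟩
  unfold pairTest adj at h
  simp only [Bool.and_eq_true, Bool.or_eq_true, decide_eq_true_eq] at h
  rcases h.2 with h | h
  · exact col_ne_of_dirEdge hsat (dirEdge_of_dirAdj h)
  · exact (col_ne_of_dirEdge hsat (dirEdge_of_dirAdj h)).symm

end Completeness

/-! ### §8. A proper `3`-colouring of `G_φ` yields a satisfying assignment -/

section Soundness

variable {m : ℕ} {var : ℕ → ℕ} {pol : ℕ → Bool} {c : ℕ → ℕ}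
  (hc3 : ∀ a, c a < 3) (hE : ∀ a b, DirEdge m var pol a b → c a ≠ c b)
include hc3 hE

omit hc3 hE in
/-- Three pairwise distinct colours `< 3` exhaust the palette. [folklore] -/
private theorem eq_third {x y z w : ℕ} (hx : x < 3) (hy : y < 3) (hz : z < 3) (hxy : x ≠ y) (hxz : x ≠ z)
    (hyz : y ≠ z) (hw : w < 3) (h1 : w ≠ x) (h2 : w ≠ y) : w = z := by omega

omit hc3 hE in
/-- The Garey–Johnson OR-gadget: if both inputs carry the colour `φ`, so does the output. [cite: GareyJohnsonStockmeyer1976, Thm 2.1 (OR-gadget)] -/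
private theorem or_gadget_out {φ g₁ g₂ o : ℕ} (hφ : φ < 3) (h₁ : g₁ < 3) (h₂ : g₂ < 3) (ho : o < 3)
    (n₁ : g₁ ≠ φ) (n₂ : g₂ ≠ φ) (h12 : g₁ ≠ g₂) (ho₁ : o ≠ g₁) (ho₂ : o ≠ g₂) : o = φ := by omega

omit hc3 in
/-- The palette triangle carries three distinct colours. [cite: GareyJohnsonStockmeyer1976, Thm 2.1 (proof, "only if")] -/
theorem pal_ne : c 0 ≠ c (slotL 0 0) ∧ c 0 ≠ c (slotL (KB m) 0) ∧ c (slotL 0 0) ≠ c (slotL (KB m) 0) :=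
  ⟨hE _ _ DirEdge.pal₁, hE _ _ DirEdge.pal₂, hE _ _ DirEdge.pal₃⟩

/-- In a diamond, `w` has the colour of `u` and `x, y` the two others. [cite: GareyJohnsonStockmeyer1976, §2 (vertex substitute)] -/
theorem diamond_col {k : ℕ} (hk : k < KS m) :
    c (slotL k 3) = c (slotL k 0) ∧ c (slotL k 1) ≠ c (slotL k 0) ∧ c (slotL k 2) ≠ c (slotL k 0) ∧
      c (slotL k 1) ≠ c (slotL k 2) := by
  have h01 := hE _ _ (DirEdge.diamond k 0 1 hk (by omega) (by omega) (Or.inl ⟨rfl, Or.inl rfl⟩))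
  have h02 := hE _ _ (DirEdge.diamond k 0 2 hk (by omega) (by omega) (Or.inl ⟨rfl, Or.inr rfl⟩))
  have h12 := hE _ _ (DirEdge.diamond k 1 2 hk (by omega) (by omega) (Or.inr (Or.inl ⟨rfl, Or.inl rfl⟩)))
  have h13 := hE _ _ (DirEdge.diamond k 1 3 hk (by omega) (by omega) (Or.inr (Or.inl ⟨rfl, Or.inr rfl⟩)))
  have h23 := hE _ _ (DirEdge.diamond k 2 3 hk (by omega) (by omega) (Or.inr (Or.inr ⟨rfl, rfl⟩)))
  have := hc3 (slotL k 0); have := hc3 (slotL k 1); have := hc3 (slotL k 2); have := hc3 (slotL k 3)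
  omega

/-- All `u`-vertices of the `B`-chain carry the colour `B = c(u_0)`. [cite: GareyJohnsonStockmeyer1976, §2 (vertex substitute)] -/
theorem chainB_col : ∀ k, k < KB m → c (slotL k 0) = c (slotL 0 0) := by
  have hKB : KB m < KS m := KB_lt_KS m
  intro k
  induction k with
  | zero => intro; rfl
  | succ k ih =>
    intro hk
    have hprev := ih (by omega)
    obtain ⟨-, hx, hy, hxy⟩ := diamond_col hc3 hE (show k < KS m by omega)
    have e1 := hE _ _ (DirEdge.chain k 1 (by omega) (by omega) (Or.inl rfl))
    have e2 := hE _ _ (DirEdge.chain k 2 (by omega) (by omega) (Or.inr rfl))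
    have := hc3 (slotL k 0); have := hc3 (slotL k 1); have := hc3 (slotL k 2); have := hc3 (slotL (k + 1) 0)
    omega

/-- All `u`-vertices of the `F`-chain carry the colour `F = c(u_{KB})`. [cite: GareyJohnsonStockmeyer1976, §2 (vertex substitute)] -/
theorem chainF_col : ∀ e, KB m + e < KS m → c (slotL (KB m + e) 0) = c (slotL (KB m) 0) := by
  intro e
  induction e with
  | zero => intro; rfl
  | succ e ih =>
    intro he
    have hprev := ih (by omega)
    obtain ⟨-, hx, hy, hxy⟩ := diamond_col hc3 hE (show KB m + e < KS m by omega)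
    have e1 := hE _ _ (DirEdge.chain (KB m + e) 1 (by omega) (by omega) (Or.inl rfl))
    have e2 := hE _ _ (DirEdge.chain (KB m + e) 2 (by omega) (by omega) (Or.inr rfl))
    rw [show KB m + (e + 1) = KB m + e + 1 by omega]
    have := hc3 (slotL (KB m + e) 0); have := hc3 (slotL (KB m + e) 1); have := hc3 (slotL (KB m + e) 2)
    have := hc3 (slotL (KB m + e + 1) 0)
    omega

/-- The two units of an occurrence avoid `B` and each other. [cite: GareyJohnsonStockmeyer1976, Thm 2.1 (x_i, x̄_i, B form a triangle)] -/
theorem unit_col {r : ℕ} (hr : r < 3 * m) :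
    c (unitL m r 0) ≠ c (slotL 0 0) ∧ c (unitL m r 1) ≠ c (slotL 0 0) ∧ c (unitL m r 0) ≠ c (unitL m r 1) := by
  have hk : 1 + r < KS m := by unfold KS; omega
  have hw := (diamond_col hc3 hE hk).1
  have hu := chainB_col hc3 hE (1 + r) (by unfold KB; omega)
  have e0 := hE _ _ (DirEdge.anchor r 0 hr (by omega))
  have e1 := hE _ _ (DirEdge.anchor r 1 hr (by omega))
  have e2 := hE _ _ (DirEdge.pair r hr)
  rw [hw, hu] at e0 e1
  exact ⟨e0, e1, e2⟩

/-- **Variable consistency**: all `a`-units of one variable carry one colour (induction along the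
chain of previous occurrences). [cite: GareyJohnsonStockmeyer1976, §2 (vertex substitute preserves colour)] -/
theorem var_consistent : ∀ r, r < 3 * m → ∀ r', r' ≤ r → var r' = var r →
    c (unitL m r' 0) = c (unitL m r 0) := by
  intro r
  induction r using Nat.strong_induction_on with
  | _ r ih =>
    intro hr r' hr' hv
    rcases Nat.lt_or_eq_of_le hr' with hlt | rfl
    · obtain ⟨r₀, hr₀⟩ := lastOcc_isSome var (var r) (n := r) ⟨r', hlt, hv⟩
      obtain ⟨h1, h2, h3⟩ := (lastOcc_eq_some_iff var (var r) r r₀).1 hr₀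
      have e := hE _ _ (DirEdge.varChain r₀ r h1 hr h2 h3)
      obtain ⟨ha, hb, hab⟩ := unit_col hc3 hE (show r₀ < 3 * m by omega)
      obtain ⟨ha', -, -⟩ := unit_col hc3 hE hr
      have hr'r₀ : r' ≤ r₀ := by
        by_contra hgt
        exact h3 r' (by omega) hlt hv
      have h4 := ih r₀ h1 (by omega) r' hr'r₀ (hv.trans h2.symm)
      have := hc3 (unitL m r₀ 0); have := hc3 (unitL m r₀ 1); have := hc3 (unitL m r 0)
      have := hc3 (slotL 0 0)
      omega
    · rfl

/-- **The assignment read off a colouring**: a variable is true iff some (equivalently every)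
`a`-unit of it carries the colour `T = c(T₀)`. [cite: GareyJohnsonStockmeyer1976, Thm 2.1 (proof, "only if")] -/
noncomputable def assign (m : ℕ) (var : ℕ → ℕ) (c : ℕ → ℕ) (v : ℕ) : Bool := by
  classical exact decide (∃ r, r < 3 * m ∧ var r = v ∧ c (unitL m r 0) = c 0)

omit hc3 hE in
/-- Unfolding `assign`. [cite: GareyJohnsonStockmeyer1976, Thm 2.1] -/
theorem assign_eq_true_iff (v : ℕ) :
    assign m var c v = true ↔ ∃ r, r < 3 * m ∧ var r = v ∧ c (unitL m r 0) = c 0 := by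
  unfold assign; simp only [decide_eq_true_eq]

/-- On an occurrence the assignment is the colour of its `a`-unit. [cite: GareyJohnsonStockmeyer1976, Thm 2.1] -/
theorem assign_var_iff {r : ℕ} (hr : r < 3 * m) : assign m var c (var r) = true ↔ c (unitL m r 0) = c 0 := by
  rw [assign_eq_true_iff]
  constructor
  · rintro ⟨r', hr', hv, hc'⟩
    rcases le_total r' r with h | h
    · rw [← var_consistent hc3 hE r hr r' h hv]; exact hc'
    · rw [var_consistent hc3 hE r' hr' r h hv.symm]; exact hc'
  · intro h; exact ⟨r, hr, rfl, h⟩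

/-- **The port of `r` is coloured `T` iff the literal of `r` is true under the assignment.**
[cite: GareyJohnsonStockmeyer1976, Thm 2.1 (proof, "only if")] -/
theorem port_col_iff {r : ℕ} (hr : r < 3 * m) :
    c (port m pol r) = c 0 ↔ litT var pol (assign m var c) r = true := by
  unfold port litT
  obtain ⟨ha, hb, hab⟩ := unit_col hc3 hE hr
  obtain ⟨p1, -, -⟩ := pal_ne hE (m := m)
  have hiff := assign_var_iff hc3 hE hr
  have := hc3 (unitL m r 0); have := hc3 (unitL m r 1); have := hc3 0; have := hc3 (slotL 0 0)
  cases hp : pol r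
  · simp only [Bool.false_eq_true, if_false, beq_false, Bool.not_eq_true']
    constructor
    · intro h
      cases ha' : assign m var c (var r)
      · rfl
      · exact absurd (by rw [hiff.1 ha'] at hab; omega) (fun h => h)
    · intro h
      have : c (unitL m r 0) ≠ c 0 := fun h' => by rw [← hiff] at h'; rw [h'] at h; exact Bool.noConfusion h
      omega
  · simp only [if_true, beq_true]
    exact hiff.symm

/-- **Every clause gadget has a `T`-coloured input.** [cite: GareyJohnsonStockmeyer1976, Thm 2.1 (proof, "only if": the OR-gadget output is T only if some input is T)] -/
theorem gadget_input_T {j : ℕ} (hj : j < m) :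
    c (port m pol (3 * j)) = c 0 ∨ c (port m pol (3 * j + 1)) = c 0 ∨ c (port m pol (3 * j + 2)) = c 0 := by
  have hKB : KB m < KS m := KB_lt_KS m
  obtain ⟨p1, p2, p3⟩ := pal_ne hE (m := m)
  -- the hubs: `out` avoids `B` and `F`
  have hkB : 1 + 3 * m + j < KS m := by unfold KS; omega
  have hkF : KB m + 1 + j < KS m := by unfold KB KS; omega
  have hwB := (diamond_col hc3 hE hkB).1
  have huB := chainB_col hc3 hE (1 + 3 * m + j) (by unfold KB; omega)
  have hwF := (diamond_col hc3 hE hkF).1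
  have huF := chainF_col hc3 hE (1 + j) (by unfold KB KS; omega)
  rw [show KB m + (1 + j) = KB m + 1 + j by omega] at huF
  have eB := hE _ _ (DirEdge.hubB j hj)
  have eF := hE _ _ (DirEdge.hubF j hj)
  rw [hwB, huB] at eB
  rw [hwF, huF] at eF
  -- the inputs
  have i1 := hE _ _ (DirEdge.input j 0 hj (Or.inl rfl))
  have i2 := hE _ _ (DirEdge.input j 1 hj (Or.inr (Or.inl rfl)))
  have i3 := hE _ _ (DirEdge.input j 4 hj (Or.inr (Or.inr rfl)))
  rw [show pos 0 = 0 by simp [pos], Nat.add_zero] at i1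
  rw [show pos 1 = 1 by simp [pos]] at i2
  rw [show pos 4 = 2 by simp [pos]] at i3
  change c (port m pol (3 * j)) ≠ _ at i1
  change c (port m pol (3 * j + 1)) ≠ _ at i2
  change c (port m pol (3 * j + 2)) ≠ _ at i3
  -- the ports avoid `B`
  have hs : ∀ r, (if pol r then 0 else 1) < 2 := fun r => by split_ifs <;> omega
  have q1 : c (port m pol (3 * j)) ≠ c (slotL 0 0) := by
    unfold port; obtain ⟨ha, hb, -⟩ := unit_col hc3 hE (show 3 * j < 3 * m by omega)
    split_ifs; exacts [ha, hb]
  have q2 : c (port m pol (3 * j + 1)) ≠ c (slotL 0 0) := by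
    unfold port; obtain ⟨ha, hb, -⟩ := unit_col hc3 hE (show 3 * j + 1 < 3 * m by omega)
    split_ifs; exacts [ha, hb]
  have q3 : c (port m pol (3 * j + 2)) ≠ c (slotL 0 0) := by
    unfold port; obtain ⟨ha, hb, -⟩ := unit_col hc3 hE (show 3 * j + 2 < 3 * m by omega)
    split_ifs; exacts [ha, hb]
  -- the gadget edges
  have g01 := hE _ _ (DirEdge.gadget j 0 1 hj (by omega) (by omega) (Or.inl ⟨rfl, Or.inl rfl⟩))
  have g02 := hE _ _ (DirEdge.gadget j 0 2 hj (by omega) (by omega) (Or.inl ⟨rfl, Or.inr rfl⟩))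
  have g12 := hE _ _ (DirEdge.gadget j 1 2 hj (by omega) (by omega) (Or.inr (Or.inl ⟨rfl, rfl⟩)))
  have g23 := hE _ _ (DirEdge.gadget j 2 3 hj (by omega) (by omega) (Or.inr (Or.inr (Or.inl ⟨rfl, rfl⟩))))
  have g34 := hE _ _ (DirEdge.gadget j 3 4 hj (by omega) (by omega)
    (Or.inr (Or.inr (Or.inr (Or.inl ⟨rfl, Or.inl rfl⟩)))))
  have g35 := hE _ _ (DirEdge.gadget j 3 5 hj (by omega) (by omega)
    (Or.inr (Or.inr (Or.inr (Or.inl ⟨rfl, Or.inr rfl⟩)))))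
  have g45 := hE _ _ (DirEdge.gadget j 4 5 hj (by omega) (by omega) (Or.inr (Or.inr (Or.inr (Or.inr ⟨rfl, rfl⟩)))))
  -- `out` is coloured `T`
  have hout : c (gadL m j 5) = c 0 :=
    eq_third (hc3 _) (hc3 _) (hc3 _) p3 p1.symm p2.symm (hc3 _) eB eF
  by_contra hcon
  simp only [not_or] at hcon
  obtain ⟨n1, n2, n3⟩ := hcon
  -- the three ports are coloured `F`
  have f1 : c (port m pol (3 * j)) = c (slotL (KB m) 0) := eq_third (hc3 _) (hc3 _) (hc3 _) p1 p2 p3 (hc3 _) n1 q1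
  have f2 : c (port m pol (3 * j + 1)) = c (slotL (KB m) 0) := eq_third (hc3 _) (hc3 _) (hc3 _) p1 p2 p3 (hc3 _) n2 q2
  have f3 : c (port m pol (3 * j + 2)) = c (slotL (KB m) 0) := eq_third (hc3 _) (hc3 _) (hc3 _) p1 p2 p3 (hc3 _) n3 q3
  rw [f1] at i1; rw [f2] at i2; rw [f3] at i3
  -- first OR-gadget: `o` is coloured `F`; second OR-gadget: so is `out` — a contradiction
  have ho : c (gadL m j 2) = c (slotL (KB m) 0) :=
    or_gadget_out (hc3 _) (hc3 _) (hc3 _) (hc3 _) i1.symm i2.symm g01 g02.symm g12.symm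
  have ho' : c (gadL m j 5) = c (slotL (KB m) 0) :=
    or_gadget_out (hc3 _) (hc3 _) (hc3 _) (hc3 _) (ho ▸ g23.symm) i3.symm g34 g35.symm g45.symm
  exact p2 (hout.symm.trans ho')

/-- **Soundness**: a proper `3`-colouring of `G_φ` yields an assignment satisfying every clause.
[cite: GareyJohnsonStockmeyer1976, Thm 2.1 (proof, "only if" direction)] -/
theorem sat_of_proper : ∀ j, j < m → litT var pol (assign m var c) (3 * j) = true ∨
    litT var pol (assign m var c) (3 * j + 1) = true ∨ litT var pol (assign m var c) (3 * j + 2) = true := by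
  intro j hj
  rw [← port_col_iff hc3 hE (by omega), ← port_col_iff hc3 hE (by omega), ← port_col_iff hc3 hE (by omega)]
  exact gadget_input_T hc3 hE hj

end Soundness

/-! ### §9. The occurrence data of a CNF and the main equivalence -/

section CNFData

open Literature.Computability.Complexity

/-- **The literal of occurrence `r`** of a CNF: the `(r mod 3)`-th literal of clause `⌊r/3⌋`, or its
FIRST literal when the clause has fewer literals (padding a clause of width `< 3` by repetition;
junk `(0, false)` off the clauses). [cite: GareyJohnsonStockmeyer1976, Thm 2.1 (clauses of exactly three literals; padding by repetition)] -/
def litOf (φ : CNF ℕ) (r : ℕ) : Literal ℕ :=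
  (φ.getD (r / 3) []).getD (if r % 3 < (φ.getD (r / 3) []).length then r % 3 else 0) (0, false)

/-- The variable of occurrence `r`. [cite: GareyJohnsonStockmeyer1976, Thm 2.1] -/
def varOf (φ : CNF ℕ) (r : ℕ) : ℕ := (litOf φ r).1

/-- The polarity of occurrence `r`. [cite: GareyJohnsonStockmeyer1976, Thm 2.1] -/
def polOf (φ : CNF ℕ) (r : ℕ) : Bool := (litOf φ r).2

/-- **The edge test of the graph `G_φ` of a CNF `φ`** (`m = φ.length` clauses).
[cite: BlaserDorflerIkenmeyer2020, Thm 22 (proof)] [cite: GareyJohnsonStockmeyer1976, Thm 2.1, §2] -/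
def cnfAdj (φ : CNF ℕ) : ℕ → ℕ → Bool := adj φ.length (varOf φ) (polOf φ)

/-- `litT` is the value of the literal of the occurrence. [cite: GareyJohnsonStockmeyer1976, Thm 2.1] -/
theorem litT_eq (φ : CNF ℕ) (σ : ℕ → Bool) (r : ℕ) :
    litT (varOf φ) (polOf φ) σ r = (litOf φ r).eval σ := rfl

/-- The literal of occurrence `3j + p`, `p < 3`, of a clause `j < m`. [cite: GareyJohnsonStockmeyer1976, Thm 2.1] -/
theorem litOf_eq (φ : CNF ℕ) {j p : ℕ} (hj : j < φ.length) (hp : p < 3) :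
    litOf φ (3 * j + p) = φ[j].getD (if p < φ[j].length then p else 0) (0, false) := by
  unfold litOf
  have h1 : (3 * j + p) / 3 = j := by omega
  have h2 : (3 * j + p) % 3 = p := by omega
  rw [h1, h2, List.getD_eq_getElem φ [] hj]

/-- **A clause holds iff one of its three (padded) occurrences carries a true literal.**
[cite: GareyJohnsonStockmeyer1976, Thm 2.1 (padding by repetition)] -/
theorem clause_iff (φ : CNF ℕ) (σ : ℕ → Bool) {j : ℕ} (hj : j < φ.length) (hne : φ[j] ≠ [])
    (hw : φ[j].length ≤ 3) :
    (litT (varOf φ) (polOf φ) σ (3 * j) = true ∨ litT (varOf φ) (polOf φ) σ (3 * j + 1) = true ∨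
      litT (varOf φ) (polOf φ) σ (3 * j + 2) = true) ↔ φ[j].any (Literal.eval σ) = true := by
  have hlen : 0 < φ[j].length := List.length_pos_iff.2 hne
  have key : ∀ p, p < 3 → litOf φ (3 * j + p) ∈ φ[j] := by
    intro p hp
    rw [litOf_eq φ hj hp]
    have hi : (if p < φ[j].length then p else 0) < φ[j].length := by split_ifs <;> omega
    rw [List.getD_eq_getElem _ _ hi]
    exact List.getElem_mem hi
  simp only [litT_eq, List.any_eq_true]
  constructor
  · rintro (h | h | h)
    · exact ⟨_, by simpa using key 0 (by omega), h⟩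
    · exact ⟨_, key 1 (by omega), h⟩
    · exact ⟨_, key 2 (by omega), h⟩
  · rintro ⟨l, hl, hlv⟩
    obtain ⟨p, hp, rfl⟩ := List.getElem_of_mem hl
    have hp3 : p < 3 := by omega
    have hlit : litOf φ (3 * j + p) = φ[j][p] := by
      rw [litOf_eq φ hj hp3, if_pos hp, List.getD_eq_getElem _ _ hp]
    rcases (show p = 0 ∨ p = 1 ∨ p = 2 by omega) with rfl | rfl | rfl
    · left; rw [← hlv, ← hlit]; rfl
    · right; left; rw [← hlv, ← hlit]
    · right; right; rw [← hlv, ← hlit]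

/-- **`φ` holds under `σ` iff every clause gadget has a true input.** [cite: GareyJohnsonStockmeyer1976, Thm 2.1] -/
theorem eval_iff (φ : CNF ℕ) (hne : ∀ c ∈ φ, c ≠ []) (hw : φ.IsWidthLE 3) (σ : ℕ → Bool) :
    φ.eval σ = true ↔ ∀ j, j < φ.length → (litT (varOf φ) (polOf φ) σ (3 * j) = true ∨
      litT (varOf φ) (polOf φ) σ (3 * j + 1) = true ∨ litT (varOf φ) (polOf φ) σ (3 * j + 2) = true) := by
  unfold CNF.eval
  rw [List.all_eq_true, List.forall_mem_iff_getElem]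
  constructor
  · intro h j hj
    exact (clause_iff φ σ hj (hne _ (List.getElem_mem hj)) (hw _ (List.getElem_mem hj))).2 (h j hj)
  · intro h j hj
    exact (clause_iff φ σ hj (hne _ (List.getElem_mem hj)) (hw _ (List.getElem_mem hj))).1 (h j hj)

/-- From the `pairTest` form of properness to the structural one. [cite: BlaserDorflerIkenmeyer2020, Thm 22 (proof)] -/
theorem proper_of_pairTest {m : ℕ} {var : ℕ → ℕ} {pol : ℕ → Bool} {c : ℕ → ℕ}
    (h : ∀ a b, a < nLab m → b < nLab m → pairTest (adj m var pol) a b = true → c a ≠ c b) :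
    ∀ a b, DirEdge m var pol a b → c a ≠ c b := by
  intro a b hab
  obtain ⟨ha, hb, hne⟩ := hab.bounds
  have hd := dirAdj_of_dirEdge hab
  rcases Nat.lt_or_gt_of_ne hne with hlt | hgt
  · refine h a b ha hb ?_
    unfold pairTest adj; simp [hlt, hd]
  · refine (h b a hb ha ?_).symm
    unfold pairTest adj; simp [hgt, hd]

/-- **`G_φ` is properly `3`-colourable iff `φ` is satisfiable** (CNFs with nonempty clauses of width
`≤ 3`; properness in the form of `BDI20NPHard.hwvEvalWaring_graphTableau_ne_zero_iff_coloring`).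
[cite: GareyJohnsonStockmeyer1976, Thm 2.1 (3-SAT ∝ GRAPH 3-COLOURABILITY) and §2 (degree ≤ 4)]
[cite: BlaserDorflerIkenmeyer2020, Thm 22 (proof: "f_T̂(p) ≠ 0 iff G is properly 3-colorable")] -/
theorem exists_proper_iff_satisfiable (φ : CNF ℕ) (hne : ∀ c ∈ φ, c ≠ []) (hw : φ.IsWidthLE 3) :
    (∃ c : ℕ → ℕ, (∀ a, c a < 3) ∧ ∀ a b, a < nLab φ.length → b < nLab φ.length →
      pairTest (cnfAdj φ) a b = true → c a ≠ c b) ↔ φ.Satisfiable := by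
  constructor
  · rintro ⟨c, hc3, hc⟩
    have hE := proper_of_pairTest hc
    exact ⟨assign φ.length (varOf φ) c, (eval_iff φ hne hw _).2 (sat_of_proper hc3 hE)⟩
  · rintro ⟨σ, hσ⟩
    exact exists_proper_of_sat ((eval_iff φ hne hw σ).1 hσ)

end CNFData

/-! ### §10. The tableau of `G_φ` is a yes-instance iff `φ` is satisfiable -/

section Tableau

open Literature.Computability.Complexity BDI2020

/-- `Σ = 0` iff every summand is `0` (naturals). [folklore] -/
private theorem natList_sum_eq_zero_iff (l : List ℕ) : l.sum = 0 ↔ ∀ x ∈ l, x = 0 := by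
  induction l with
  | nil => simp
  | cons x l ih => simp [ih]

/-- The number of labels of a tableau with content `n × d`, `d ≥ 1`, is determined.
[cite: BlaserDorflerIkenmeyer2020, Def 3 (arXiv; = CCC 2021 Def 5.1: content n × d)] -/
theorem le_of_isTableauOfContent {T : List (List ℕ)} {n₁ n₂ d : ℕ} (hd : 0 < d)
    (h₁ : IsTableauOfContent T n₁ d) (h₂ : IsTableauOfContent T n₂ d) : n₂ ≤ n₁ := by
  rcases Nat.eq_zero_or_pos n₂ with rfl | hpos
  · exact Nat.zero_le _
  · have hsum := h₂.2.2.2 (n₂ - 1) (by omega)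
    have hex : ∃ c ∈ T, n₂ - 1 ∈ c := by
      by_contra hne
      push Not at hne
      have h0 : (T.map (List.count (n₂ - 1))).sum = 0 := by
        rw [natList_sum_eq_zero_iff]
        intro x hx
        rw [List.mem_map] at hx
        obtain ⟨c, hc, rfl⟩ := hx
        exact List.count_eq_zero.2 (hne c hc)
      omega
    obtain ⟨c, hc, hu⟩ := hex
    have := h₁.2.2.1 c hc _ hu
    omega

/-- Columns of `T̂_G` have height `≤ 2`. [cite: BlaserDorflerIkenmeyer2020, Thm 22 (proof: columns (u,v) and (v))] -/
theorem length_le_two_of_mem_graphTableau {N d : ℕ} {E : ℕ → ℕ → Bool} {c : List ℕ}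
    (hc : c ∈ graphTableau N d E) : c.length ≤ 2 := by
  unfold graphTableau pairCols pairColsAt singleCols at hc
  simp only [List.mem_append, List.mem_flatten, List.mem_map, List.mem_range] at hc
  rcases hc with ⟨l, ⟨a, -, rfl⟩, hcl⟩ | ⟨l, ⟨a, -, rfl⟩, hcl⟩
  · simp only [List.mem_flatten, List.mem_map, List.mem_range] at hcl
    obtain ⟨l', ⟨b, -, rfl⟩, hcl'⟩ := hcl
    split_ifs at hcl' with h
    · simp only [List.mem_cons, List.not_mem_nil, or_false] at hcl'
      rcases hcl' with rfl | rfl <;> simp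
    · simp at hcl'
  · rw [List.mem_replicate] at hcl
    rw [hcl.2]; simp

/-- `foldr max 0` is bounded by a common bound of the entries. [folklore] -/
private theorem foldr_max_le {l : List ℕ} {b : ℕ} (h : ∀ x ∈ l, x ≤ b) : l.foldr max 0 ≤ b := by
  induction l with
  | nil => simp
  | cons x l ih =>
    simp only [List.foldr_cons]
    exact max_le (h x (by simp)) (ih fun y hy => h y (by simp [hy]))

/-- A tableau with entries `< N` (`N ≥ 1`) has `numLabels ≤ N`. [cite: BlaserDorflerIkenmeyer2020, Def 3 (arXiv; = CCC 2021 Def 5.1)] -/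
theorem numLabels_le_of_forall_lt {T : List (List ℕ)} {N : ℕ} (hN : 0 < N)
    (h : ∀ c ∈ T, ∀ u ∈ c, u < N) : numLabels T ≤ N := by
  unfold numLabels
  have : (T.map fun c => c.foldr max 0).foldr max 0 ≤ N - 1 := by
    apply foldr_max_le
    intro x hx
    rw [List.mem_map] at hx
    obtain ⟨c, hc, rfl⟩ := hx
    exact foldr_max_le fun u hu => by have := h c hc u hu; omega
  omega

/-- **The number of labels of `T̂_{G_φ}` is at most `32m + 9`.** [cite: BlaserDorflerIkenmeyer2020, Thm 22 (proof: content n × d)] -/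
theorem numLabels_graphTableau_cnfAdj_le (φ : CNF ℕ) {d : ℕ} (hd : 8 ≤ d) :
    numLabels (graphTableau (nLab φ.length) d (cnfAdj φ)) ≤ nLab φ.length := by
  have hdeg : ∀ a, a < nLab φ.length → 2 * edgeDeg (nLab φ.length) (cnfAdj φ) a ≤ d := fun a _ => by
    have := edgeDeg_adj_le φ.length (varOf φ) (polOf φ) (nLab φ.length) a
    unfold cnfAdj; omega
  have hcont := isTableauOfContent_graphTableau _ d _ hdeg
  exact numLabels_le_of_forall_lt (by unfold nLab; omega) hcont.2.2.1

/-- **The tableau `T̂_{G_φ}` is a yes-instance of BDI's evaluation problem (`d ≥ 8`, `m ≥ 2`) iff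
`φ` is satisfiable.** [cite: BlaserDorflerIkenmeyer2020, Thm 22 (proof), arXiv p0017.txt:L26-48 (= CCC 2021 Thm 8.1)] -/
theorem graphTableau_cnfAdj_mem_iff (φ : CNF ℕ) (hne : ∀ c ∈ φ, c ≠ []) (hw : φ.IsWidthLE 3) {d M : ℕ}
    (hd : 8 ≤ d) (hM : 2 ≤ M) :
    graphTableau (nLab φ.length) d (cnfAdj φ) ∈ nonvanishingSet₃ d M ↔ φ.Satisfiable := by
  have hdeg : ∀ a, a < nLab φ.length → 2 * edgeDeg (nLab φ.length) (cnfAdj φ) a ≤ d := fun a _ => by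
    have := edgeDeg_adj_le φ.length (varOf φ) (polOf φ) (nLab φ.length) a
    unfold cnfAdj; omega
  have hcont := isTableauOfContent_graphTableau _ d _ hdeg
  rw [← exists_proper_iff_satisfiable φ hne hw]
  unfold nonvanishingSet₃
  rw [Set.mem_setOf_eq]
  constructor
  · rintro ⟨n', hn', -, hval⟩
    have h' : n' = nLab φ.length :=
      le_antisymm (le_of_isTableauOfContent (by omega) hcont hn') (le_of_isTableauOfContent (by omega) hn' hcont)
    subst h'
    exact (hwvEvalWaring_graphTableau_ne_zero_iff_coloring _ _ _).1 hval
  · intro hcol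
    exact ⟨nLab φ.length, hcont, fun c hc => (length_le_two_of_mem_graphTableau hc).trans hM,
      (hwvEvalWaring_graphTableau_ne_zero_iff_coloring _ _ _).2 hcol⟩

end Tableau

end BDI20SatGraph

end Literature.Computability.AlgebraicComplexity
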